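import Literature.MathematicalPhysics.QuantumFieldTheory.Balaban1983to89.B9Ineq377POne

/-!
# `Balaban1983to89.B9Ineq368PPrimeDs` — B9 p. 403 (3.68), the RIGHT-dressed entries `|(P′(A)D*)_ν(x,x′)|` and
# `|(DP′(A)D*)_{μν}(x,x′)|` in the block-majorant (operator) form of [4] (2.51), DERIVED from Theorem-3.1/3.2-shaped inputs,
# the (3.63)-product, the DIVERGENCE FORM of `V′(A)` and entry (3.42)₃ at `U` and `U′U`; and (3.77) with all four
# (3.68)-entries discharged

HONEST FRAMING (cell `lit-balaban`, verbatim): statement-level skeleton of published theorems with citation tags; proofs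
where landed; nothing here is a claim about the Yang–Mills mass gap.

DOCFIX (cell `lit-balaban`, seat r06 gen 15, 2026-08-22; p37 `CITELOC-SWEEP-B4B9.md` §2b page-numeral slips, text layer re-read): (3.57) is p. 401 [PDF 13] ((3.58)–(3.65) p. 402, (3.65)bis–(3.68) p. 403) — the locators of (3.57)–(3.67) in this file corrected accordingly (3 place(s)); declarations, statements and proofs byte-identical to the tree copy of record (p256103).

CITATION HEADER (lean-in-tree rule).  T. Bałaban, *Propagators for lattice gauge theories in a background field*, Commun.
Math. Phys. **99** (1985) 389–434 [`Balaban1985BackgroundPropagators`] (cell paper B9; journal page = PDF page + 388):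
p. 403 [PDF 15] (3.68); p. 401–402 [PDF 13–14] (3.50)–(3.53), (3.57)–(3.65); p. 397–398 [PDF 9–10] Theorem 3.1 (3.42) and
the two remarks after Theorem 3.1; p. 396 [PDF 8] (3.37); p. 405–406 [PDF 17–18] (3.76)–(3.77); [4] = T. Bałaban,
*Propagators and renormalization transformations for lattice gauge theories. II*, Commun. Math. Phys. **96** (1984) 223–250
[`Balaban1984PropagatorsII`], (2.51)–(2.55) p. 232, Lemma 2.1 p. 234.  Text read from the held text layer (`lit read
paper:balaban1985-cmp99-background-propagators --pages 9-20`) and the renders `…-p009/p010/p014/p015/p017/p018-x2.png` READ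
AS IMAGES by this seat (2026-08-21).  Cell `lit-balaban` seat r06 gen 7 (B9 fold owner), SKELETON rows `B9.Eq3.68` (entries
3–4 so far «LOCATED only») and `B9.Eq3.76`.  Continuation of gen 6's `B9Ineq368PPrime` (entries 1–2; its `hasMajorant_word5`,
`transfers_word`, scale-transfer algebra and the five-word expansion are used BY NAME) and of this seat's `B9Ineq377POne`
((3.77); USED BY NAME in §4).

WHAT IS PRINTED («…» verbatim).  p. 403: «Moreover we have P(U′U) = P(U) + P′(A), |P′(A;x,x′)|, |(DP′(A))_μ(x,x′)|,
|(P′(A)D\*)_ν(x,x′)|, |(DP′(A)D\*)_{μν}(x,x′)| ≦ O(1)α₁[1, (Lʲη)⁻¹, (Lʲη)⁻¹, (Lʲη)⁻²](L^{j′}η)^{−d}e^{−(1/2)δ₀d(y,y′)} for x ∈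
Δ(y), y ∈ Λ_j, x′ ∈ Δ(y′), y′ ∈ Λ_{j′}. (3.68) The remainder can be written explicitly in terms of the operators introduced
until now by writing the expansions of the operators determining P(U′U).»  p. 398: «At first the choice of derivatives ∇_U,
∇\*_U is conventional, we may always replace ∇_U by ∇\*_U, and vice versa, in arbitrary place and combination.»  p. 402 (3.60):
«Δ_{U′U} + Q′\*(U′U)aQ′(U′U) = Δ_U + Q′\*(U)aQ′(U) − V′₁(A) + F′₂\*(A)aQ′(U) + Q′\*(U)aF′₂(A) + F′₂\*(A)aF′₂(A) = Δ_U +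
Q′\*(U)aQ′(U) − V′(A)», p. 401 (3.53) «Δ_{U′U} = Δ_U − V′₁(A)» with (3.50)–(3.52) (`V′₁` first order in the letters
`η⁻¹(R(U′U(x,x′)) − R(U(x,x′)))`), p. 396 (3.37) «|A| < α₁(Lʲη)⁻¹, |∇^η_UA| < α₁(Lʲη)⁻² on Ω_j».

THE DIVERGENCE FORM OF `V′(A)` (the READING used here, NOT displayed in print; the same reading as pv21's
`B6RandomWalkHom.b9_rightEntry_of_365_divForm`, cell GAPS G-pv21g2-2 «the form itself is the undisplayed step»).  By
(3.50)–(3.53) and (3.60), `V′ = V′₁ − (F′₂*aQ′ + Q′*aF′₂ + F′₂*aF′₂)` with `V′₁ = −(∇*_U∘K + K*∘∇_U + K*∘K)` in the first-order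
local letters `K = D_{U′U} − D_U`, `K* = D*_{U′U} − D*_U` (`Δ_{U′U} = (D* + K*)(D + K)`); the middle term `K*∘∇_U` is a
product `A·∇λ` (plus `O(η|A|²)`), and the lattice Leibniz rule `A_ν(x+ηe_ν)·∇_νλ(x) = ∇_ν(A_νλ)(x) − (∇_νA_ν)(x)λ(x)` together
with the second bound of (3.37) moves its difference to the LEFT: `V′(A) = ∇♯·B″ + C″` with a first-difference letter `∇♯`
(conventional, p. 398) and LOCAL letters of sizes `|B″λ| ≦ O(1)α₁(Lʲη)⁻¹|λ|`, `|C″λ| ≦ O(1)α₁(Lʲη)⁻²|λ|` (the `a`-terms of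
(3.60) are block-local of size `O(1)α₁(Lʲη)⁻²` and go into `C″`).  In the homogeneous calculus: hypotheses `hV : V = Dv *
Bpp + Cpp`, `hBpp : Bpp ≺ c_Bα₁(Lʲη)⁻¹e^{−δd}`, `hCpp : Cpp ≺ c_Cα₁(Lʲη)⁻²e^{−δd}`, and entry (3.42)₃ for the letter `Dv`:
`hGDv : G * Dv ≺ B_{G3}Lʲη e^{−δd}`.

WHY THIS UNLOCKS ENTRIES 3–4 (located correction of `B9Ineq368PPrime` SCOPE (ii)).  In the five words of `P′(A)`
(`B9Eq360Vprime.pPrime_explicit`) multiplied by `D*` on the right, words 1–4 end in `G′(U′U)·D*` — entry (3.42)₃ at `U′U`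
(p. 403 l. 1–9: «We define new constants in such a way that the statements of Theorem 3.1 hold for extended operators»),
and word 1's `V′` stays inside the (3.63)-product `V′G′(U′U)`; only word 5, `G′Q′*C⁻¹Q′·(G′(U)V′(A)G′(U′U))·D*`, has `V′`
between two propagators.  Read with the GRADIENT form (3.61) this asks for `∇G′(U′U)∇*` (the Hölder entry (3.44)) — gen 6's
obstruction; read with the DIVERGENCE form, `G′(U)·V′ = (G′(U)∇♯)·B″ + G′(U)·C″` and the derivative is absorbed by entry (3.42)₃
of `G′(U)`: `G′V′G′(U′U)D* = (G′∇♯)·B″·(G′(U′U)D*) + G′·C″·(G′(U′U)D*)`.  The left end letter `X` (`G′` for entry 3, `∇G′`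
for entry 4) is untouched, so BOTH right-dressed entries follow.

WHAT THIS FILE PROVES (theorems; one real-constant definition with body `kappa368Ds`; no `Prop` placeholders, 0 new facts;
standard axioms).  SETTING as in `B9Ineq368PPrime` (pv08's `HasMajorant` over `toB6 g R H`, all letters in ONE
`Module.End ℝ (W → ℝ)`, block map `blk : W → 𝔅`).
* §1 **`hasMajorant_GVEDs`** — the sub-word `G′(U)·V′·G′(U′U)·D*` from the divergence form: `≺ α₁B_{E3}Λ⁴c²(B_{G3}c_B +
  B_Gc_C)·Lʲη·e^{−ρd}` for `ρ + 2(2α+β)δ₀ ≦ δ`.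
* §2 **`hasMajorant_pPrime_words_Ds`** — the five words of `P′(A)·D*` with a generic left end letter `X` (majorant
  `B_Xw_Xe^{−δd}`): `≺ κ₃₆₈ᴰ·α₁·w_X(Lʲη)⁻³·e^{−ρd}`, **`κ₃₆₈ᴰ = Λ⁴c²B_XB_{E3}·(c_VB_Ec(κ_Q+c_Fα₁)²B_c′ + c_FB_c′(κ_Q+c_Fα₁) +
  κ_QB_c′κ_CB_cΛ²c²(κ_Q+c_Fα₁) + κ_Qc_FB_c + κ_Q²B_cΛ⁴c²(B_{G3}c_B + B_Gc_C))`** (`kappa368Ds`).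
* §3 **`ineq368_op_Ds`** ((3.68)₃: `P′(A)·D* ≺ κ₃₆₈ᴰ(B_X = B_G)·α₁·(Lʲη)⁻¹·e^{−ρd}`) and **`ineq368_op_DDs`** ((3.68)₄:
  `D·P′(A)·D* ≺ κ₃₆₈ᴰ(B_X = B_D)·α₁·(Lʲη)⁻²·e^{−ρd}`), for `P′(A) = B9Eq360Vprime.pPrime G E Qs Qs' Cinv Cinv' Q Q'` given the
  expansions (3.57), (3.65)₁, (3.67) exactly as in gen 6's `ineq368_op`.
* §4 **`ineq377_op_of_349_368`** — (3.77) for `P₁(A) = pOne D D′ D* D′* P(U) P′(A)` with ALL SEVEN entry hypotheses of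
  `B9Ineq377POne.ineq377_op` DISCHARGED: `P`, `DP`, `PD*` by `ineq349_op`, `P′`, `DP′` by `ineq368_op`/`ineq368_op_D`, `P′D*`,
  `DP′D*` by §3 — so (3.77) rests on Theorem-3.1/3.2-shaped inputs at `U` and `U′U`, the (3.63)-product, the structural
  identities (3.57)/(3.65)/(3.67), the (3.59)/(3.66)-letters, the divergence form of `V′` and the letters `D_{U′U} − D_U`,
  `D*_{U′U} − D*_U` only (constant: `κ₃₇₇` of `B9Ineq377POne` at `κ_P = κ₃₄₉`, `κ_{P′} = 2(κ₃₆₈ + κ₃₆₈ᴰ)`).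
* §5 (v1.1, append-only) **the divergence-form letters FROM the gradient form (3.60)/(3.61) and ONE commutator letter** —
  **`ineq368_op_Ds_of_comm`**, **`ineq368_op_DDs_of_comm`**, **`ineq377_op_of_349_368_of_comm`**:
  the three divergence-form hypotheses `hV`/`hBpp`/`hCpp` (and `hGDv`) of §1–§4 DISCHARGED from the gradient-form reading
  `V′ = V⁰ + V¹∇` of (3.60)/(3.61) (`hVg`, `hV0 : V⁰ ≺ c_Cα₁(Lʲη)⁻²e^{−δd}`, `hV1 : V¹ ≺ c_Bα₁(Lʲη)⁻¹e^{−δd}`), the entry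
  `G′(U)∇ ≺ B_{G3}Lʲη e^{−δd}` («we may always replace ∇_U by ∇*_U», p. 398) and ONE located letter, the commutator
  `[V¹, ∇] = V¹∇ − ∇V¹ ≺ c_Mα₁(Lʲη)⁻²e^{−δd}` — in print the covariant difference of the coefficients `adA(·)R(U(·,·))` of
  (3.60), of size `|∇^η_UA| < α₁(Lʲη)⁻²` by (3.37) (the lattice Leibniz rule of the paragraph above, as one letter); the
  ring identity `V⁰ + V¹∇ = ∇V¹ + (V⁰ + [V¹, ∇])` does the rest.  Constants: `c_C + c_M` in place of `c_C`; `c_M = 0`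
  recovers §3–§4 verbatim.  Same device as `B9Ineq386RightEntry` §5 (v1.1) for `V₃` of (3.82).

SCOPE / NOT CLAIMED.  (i) OPERATOR (block `L^∞ → L^∞`) FORM, as in `B9Ineq368PPrime` (i); the printed pointwise factor
`(L^{j′}η)^{−d}` is not used.  (ii) The divergence form of `V′` is a READING (above; GAPS G-pv21g2-2), entering as the three
hypotheses `hV`/`hBpp`/`hCpp`; the Leibniz identity on a concrete carrier is pv27's vocabulary (`B9Eq352ScalarFluct`,
`B9Eq370Expansion`) and is not typed here.  (iii) Entry (3.42)₃ at `U′U` (`hEDs`) is an input of printed TYPE (p. 403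
l. 1–9); its own derivation in the block calculus is pv21's `b9_rightEntry_of_365_divForm` (for `G′`).  (iv) Rates: `ρ` any
rate with the stated margin below the common input rate `δ` (print: «½δ₀» in its re-defined-constants convention,
`B9Ineq349.rates_349`, GAPS G-B9-21).  (v) Nothing of analyticity or of the series' end-statement.  Value = the two remaining
entries of the printed (3.68) and the complete (3.68)-discharge of (3.77), kernel-checked in operator form with constants,
NOT summit progress.

RELATED IN THE TREE, NOT DUPLICATED (searched 2026-08-21: `ls Balaban1983to89/ | grep -i '368'` = `B9Ineq368PPrime` only;
`lean search 'ineq368_op'`): `B9Ineq368PPrime` (entries 1–2, USED BY NAME; its SCOPE (ii) sentence is superseded by §3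
here for the block form), `B9Ineq377POne` ((3.77) with entry hypotheses, USED BY NAME), `B6RandomWalkHom`
(`b9_rightEntry_of_365_divForm`: the divergence-form route for `G′(U′U)∇*`, two-space calculus), `B9Eq360Vprime` (`pPrime`,
`pPrime_explicit`, `pOp`, USED BY NAME).
-/

noncomputable section

namespace Literature.MathematicalPhysics.QuantumFieldTheory.Balaban1983to89.B9Ineq368PPrimeDs

open Literature.MathematicalPhysics.QuantumFieldTheory.Balaban1983to89
open Literature.MathematicalPhysics.QuantumFieldTheory.Balaban1983to89.B6RandomWalk (HasMajorant BlockSupp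
  hasMajorant_mono hasMajorant_mul hasMajorant_add Triangle254 Ineq261)
open Literature.MathematicalPhysics.QuantumFieldTheory.Balaban1983to89.B9Thm34Ext (toB6)
open Literature.MathematicalPhysics.QuantumFieldTheory.Balaban1983to89.B9Ineq347 (ScaleTransfer)
open Literature.MathematicalPhysics.QuantumFieldTheory.Balaban1983to89.B9Ineq366CPrime (hasMajorant_comp_decay
  hasMajorant_comp_decay_left1 hasMajorant_comp_decay_right1 hasMajorant_rate_mono hasMajorant_local_mul
  hasMajorant_mul_local)
open Literature.MathematicalPhysics.QuantumFieldTheory.Balaban1983to89.B9Ineq368PPrime (hasMajorant_neg hasMajorant_sub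
  hasMajorant_local_add hasMajorant_word5 transfers_word scaleTransfer_mul scaleTransfer_exp_mono scaleTransfer_const_mono
  kappa349 kappa368)
open Literature.MathematicalPhysics.QuantumFieldTheory.Balaban1983to89.B9Ineq377POne (kappa377)
open Literature.MathematicalPhysics.QuantumFieldTheory.Balaban1983to89.B9Eq386Neumann (pOne)

variable {g : B9.Geometry} [Fintype g.Site] [DecidableEq g.Site] {R : ℝ} {H : Prop} {W : Type}

omit [Fintype g.Site] [DecidableEq g.Site] in
/-- `Λ ≦ Λ²` for `Λ ≧ 1`. [folklore] -/
private theorem le_sq_of_one_le' {Λ : ℝ} (hΛ : 1 ≤ Λ) : Λ ≤ Λ ^ 2 := by nlinarith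

omit [Fintype g.Site] [DecidableEq g.Site] in
/-- A primitive scale transfer at exponent `α` (constant `Λ ≧ 1`) is one at exponent `2α` with constant `Λ²`.
[cite: Balaban1985BackgroundPropagators, p.398 remark after (3.47)] -/
theorem transfer_two {δ₀ α Λ : ℝ} {w : g.Site → ℝ} (hw : ∀ a, 0 ≤ w a) (hΛ : 1 ≤ Λ) (hα : 0 ≤ α) (hδ₀ : 0 ≤ δ₀)
    (hdnn : ∀ a b : g.Site, 0 ≤ g.dist a b) (hT : ScaleTransfer g δ₀ α Λ w) :
    ScaleTransfer g δ₀ (2 * α) (Λ ^ 2) w :=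
  scaleTransfer_const_mono hw (le_sq_of_one_le' hΛ) (scaleTransfer_exp_mono hw (by linarith) hδ₀ hdnn hT)

/-! ## §1  The sub-word `G′(U)·V′(A)·G′(U′U)·D*` from the divergence form of `V′` -/

omit [DecidableEq g.Site] in
/-- **Word 5 of `P′(A)·D*`, the propagator sandwich `G′(U)·V′(A)·G′(U′U)·D*`**, read with the DIVERGENCE FORM
`V′ = ∇♯·B″ + C″` (`hV`; `B″ ≺ c_Bα₁(Lʲη)⁻¹e^{−δd}`, `C″ ≺ c_Cα₁(Lʲη)⁻²e^{−δd}`): `G′V′G′(U′U)D* = (G′∇♯)·B″·(G′(U′U)D*) +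
G′·C″·(G′(U′U)D*)`, and with (3.42)₁,₃ at `U` (`G ≺ B_G(Lʲη)²e^{−δd}`, `G∇♯ ≺ B_{G3}Lʲη e^{−δd}`), (3.42)₃ at `U′U`
(`G′(U′U)D* ≺ B_{E3}Lʲη e^{−δd}`), the scale transfers of `Lʲη`, `(Lʲη)⁻¹`, `(Lʲη)⁻²` and Lemma 2.1 of [4]:
`G′V′G′(U′U)D* ≺ α₁B_{E3}Λ⁴c²(B_{G3}c_B + B_Gc_C)·Lʲη·e^{−ρ d(y,y′)}` for `ρ + 2(2α+β)δ₀ ≦ δ` (two compositions per term).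
[cite: Balaban1985BackgroundPropagators, (3.68) p.403 + (3.60)–(3.61) p.402 + (3.42) p.397 + p.398 remarks; Balaban1984PropagatorsII, Lemma 2.1 p.234 + (2.52)–(2.55) p.232] -/
theorem hasMajorant_GVEDs (blk : W → g.Site) (d : ℕ) (δ₀ δ α β ρ Λ BG BG3 BE3 cB cC α₁ : ℝ)
    (hBG : 0 ≤ BG) (hBG3 : 0 ≤ BG3) (hBE3 : 0 ≤ BE3) (hcB : 0 ≤ cB) (hcC : 0 ≤ cC) (hα₁ : 0 ≤ α₁) (hΛ : 1 ≤ Λ)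
    (hρ : 0 ≤ ρ) (hα : 0 ≤ α) (hβ : 0 ≤ β) (hδ₀ : 0 ≤ δ₀) (hr : ρ + 2 * ((2 * α + β) * δ₀) ≤ δ)
    (hdnn : ∀ a b : g.Site, 0 ≤ g.dist a b) (htri : Triangle254 (toB6 g R H)) (hlen : ∀ y : g.Site, 0 < g.len y)
    (h261 : Ineq261 d (toB6 g R H) δ₀ β)
    (hT1 : ScaleTransfer g δ₀ α Λ (fun a => g.len a)) (hT1i : ScaleTransfer g δ₀ α Λ (fun a => (g.len a)⁻¹))
    (hT2i : ScaleTransfer g δ₀ α Λ (fun a => (g.len a ^ 2)⁻¹))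
    {G Dv E Ds V Bpp Cpp : Module.End ℝ (W → ℝ)} (hV : V = Dv * Bpp + Cpp)
    (hG : HasMajorant (g := toB6 g R H) blk G (fun a b => BG * g.len a ^ 2 * Real.exp (-(δ * g.dist a b))))
    (hGDv : HasMajorant (g := toB6 g R H) blk (G * Dv) (fun a b => BG3 * g.len a * Real.exp (-(δ * g.dist a b))))
    (hEDs : HasMajorant (g := toB6 g R H) blk (E * Ds) (fun a b => BE3 * g.len a * Real.exp (-(δ * g.dist a b))))
    (hBpp : HasMajorant (g := toB6 g R H) blk Bpp (fun a b => cB * α₁ * (g.len a)⁻¹ * Real.exp (-(δ * g.dist a b))))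
    (hCpp : HasMajorant (g := toB6 g R H) blk Cpp
      (fun a b => cC * α₁ * (g.len a ^ 2)⁻¹ * Real.exp (-(δ * g.dist a b)))) :
    HasMajorant (g := toB6 g R H) blk (G * V * E * Ds)
      (fun a b => (α₁ * BE3 * Λ ^ 4 * B6.c1 d δ₀ β ^ 2 * (BG3 * cB + BG * cC)) * g.len a *
        Real.exp (-(ρ * g.dist a b))) := by
  -- constants, weights, rates
  set c : ℝ := B6.c1 d δ₀ β with hc_def
  have hc0 : 0 ≤ c := B6RandomWalk.c1_nonneg d δ₀ β
  have hw1 : ∀ a : g.Site, 0 ≤ g.len a := fun a => (hlen a).le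
  have hw2 : ∀ a : g.Site, 0 ≤ g.len a ^ 2 := fun a => sq_nonneg _
  have hw1i : ∀ a : g.Site, 0 ≤ (g.len a)⁻¹ := fun a => inv_nonneg.mpr (hlen a).le
  have hw2i : ∀ a : g.Site, 0 ≤ (g.len a ^ 2)⁻¹ := fun a => inv_nonneg.mpr (sq_nonneg _)
  have hΛ0 : 0 ≤ Λ := zero_le_one.trans hΛ
  have hΛ2 : 0 ≤ Λ ^ 2 := by positivity
  have hcBα : 0 ≤ cB * α₁ := mul_nonneg hcB hα₁
  have hcCα : 0 ≤ cC * α₁ := mul_nonneg hcC hα₁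
  have hε : 0 ≤ (2 * α + β) * δ₀ := by positivity
  set r₁ : ℝ := ρ + (2 * α + β) * δ₀ with hr₁_def
  have hρr₁ : ρ + (2 * α + β) * δ₀ ≤ r₁ := le_of_eq hr₁_def.symm
  have hρr₁' : ρ ≤ r₁ := by rw [hr₁_def]; linarith
  have hr₁0 : 0 ≤ r₁ := hρ.trans hρr₁'
  have hr₁δ : r₁ + (2 * α + β) * δ₀ ≤ δ := by rw [hr₁_def]; linarith
  have hr₁δ' : r₁ ≤ δ := by linarith
  have hρδ : ρ ≤ δ := hρr₁'.trans hr₁δ'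
  -- transfers at exponent 2α, constant Λ²
  have t1 := transfer_two (g := g) hw1 hΛ hα hδ₀ hdnn hT1
  have t1i := transfer_two (g := g) hw1i hΛ hα hδ₀ hdnn hT1i
  have t2i := transfer_two (g := g) hw2i hΛ hα hδ₀ hdnn hT2i
  -- weakened letters
  have hBppr := hasMajorant_rate_mono (R := R) (H := H) blk (cB * α₁) (fun a => (g.len a)⁻¹) hcBα hw1i hr₁δ' hdnn
    hBpp
  have hCppr := hasMajorant_rate_mono (R := R) (H := H) blk (cC * α₁) (fun a => (g.len a ^ 2)⁻¹) hcCα hw2i hr₁δ'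
    hdnn hCpp
  have hEDsρ := hasMajorant_rate_mono (R := R) (H := H) blk BE3 (fun a => g.len a) hBE3 hw1 hρδ hdnn hEDs
  -- term 1: ((G·∇♯)·B″)·(G′(U′U)D*)
  have s1 := hasMajorant_comp_decay (R := R) (H := H) blk d δ₀ (2 * α) β r₁ δ (Λ ^ 2) BG3 (cB * α₁)
    (fun a => g.len a) (fun a => (g.len a)⁻¹) hw1 hw1i hΛ2 hBG3 hcBα hr₁0 hr₁δ hdnn htri t1i h261 hGDv hBppr
  have s2 := hasMajorant_comp_decay (R := R) (H := H) blk d δ₀ (2 * α) β ρ r₁ (Λ ^ 2) (BG3 * (cB * α₁) * Λ ^ 2 * c) BE3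
    (fun a => g.len a * (g.len a)⁻¹) (fun a => g.len a) (fun a => mul_nonneg (hw1 a) (hw1i a)) hw1 hΛ2 (by positivity)
    hBE3 hρ hρr₁ hdnn htri t1 h261 s1 hEDsρ
  -- term 2: (G·C″)·(G′(U′U)D*)
  have s3 := hasMajorant_comp_decay (R := R) (H := H) blk d δ₀ (2 * α) β r₁ δ (Λ ^ 2) BG (cC * α₁)
    (fun a => g.len a ^ 2) (fun a => (g.len a ^ 2)⁻¹) hw2 hw2i hΛ2 hBG hcCα hr₁0 hr₁δ hdnn htri t2i h261 hG hCppr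
  have s4 := hasMajorant_comp_decay (R := R) (H := H) blk d δ₀ (2 * α) β ρ r₁ (Λ ^ 2) (BG * (cC * α₁) * Λ ^ 2 * c) BE3
    (fun a => g.len a ^ 2 * (g.len a ^ 2)⁻¹) (fun a => g.len a) (fun a => mul_nonneg (hw2 a) (hw2i a)) hw1 hΛ2
    (by positivity) hBE3 hρ hρr₁ hdnn htri t1 h261 s3 hEDsρ
  have hsum := hasMajorant_add (g := toB6 g R H) blk s2 s4
  have e : G * V * E * Ds = G * Dv * Bpp * (E * Ds) + G * Cpp * (E * Ds) := by
    rw [hV]; noncomm_ring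
  rw [e]
  refine hasMajorant_mono (g := toB6 g R H) blk hsum fun a b => le_of_eq ?_
  have ha : g.len a ≠ 0 := (hlen a).ne'
  field_simp
  ring

/-! ## §2  The five words of `P′(A)·D*` -/

/-- The explicit `O(1)` of (3.68)₃,₄ produced here (cf. `B9Ineq368PPrime.kappa368`: the right end constant `B_E` of the
words becomes the entry-3 constant `B_{E3}` of `G′(U′U)D*`, and the last word's `B_Gc_Vc` becomes the divergence-form
constant `Λ⁴c²(B_{G3}c_B + B_Gc_C)`):
`κ₃₆₈ᴰ = Λ⁴c²B_XB_{E3}·(c_VB_Ec(κ_Q+c_Fα₁)²B_c′ + c_FB_c′(κ_Q+c_Fα₁) + κ_QB_c′κ_CB_cΛ²c²(κ_Q+c_Fα₁) + κ_Qc_FB_c +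
κ_Q²B_cΛ⁴c²(B_{G3}c_B + B_Gc_C))`. [cite: Balaban1985BackgroundPropagators, (3.68) p.403] -/
def kappa368Ds (κQ cF cV κC BG BG3 BX BE BE3 Bc Bc' cB cC Λ c α₁ : ℝ) : ℝ :=
  Λ ^ 4 * c ^ 2 * BX * BE3 *
    (cV * BE * c * (κQ + cF * α₁) ^ 2 * Bc' + cF * Bc' * (κQ + cF * α₁)
      + κQ * Bc' * κC * Bc * Λ ^ 2 * c ^ 2 * (κQ + cF * α₁) + κQ * cF * Bc
      + κQ ^ 2 * Bc * Λ ^ 4 * c ^ 2 * (BG3 * cB + BG * cC))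

omit [Fintype g.Site] [DecidableEq g.Site] in
/-- `κ₃₆₈ᴰ ≧ 0` for non-negative constants. [cite: Balaban1985BackgroundPropagators, (3.68) p.403] -/
theorem kappa368Ds_nonneg {κQ cF cV κC BG BG3 BX BE BE3 Bc Bc' cB cC Λ c α₁ : ℝ} (hκQ : 0 ≤ κQ) (hcF : 0 ≤ cF)
    (hcV : 0 ≤ cV) (hκC : 0 ≤ κC) (hBG : 0 ≤ BG) (hBG3 : 0 ≤ BG3) (hBX : 0 ≤ BX) (hBE : 0 ≤ BE) (hBE3 : 0 ≤ BE3)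
    (hBc : 0 ≤ Bc) (hBc' : 0 ≤ Bc') (hcB : 0 ≤ cB) (hcC : 0 ≤ cC) (hc : 0 ≤ c) (hα₁ : 0 ≤ α₁) :
    0 ≤ kappa368Ds κQ cF cV κC BG BG3 BX BE BE3 Bc Bc' cB cC Λ c α₁ := by
  unfold kappa368Ds
  positivity

omit [Fintype g.Site] [DecidableEq g.Site] in
/-- `κ₃₆₈ ≧ 0` (gen 6's constant) for non-negative constants. [cite: Balaban1985BackgroundPropagators, (3.68) p.403] -/
theorem kappa368_nonneg {κQ cF cV κC BG BX BE Bc Bc' Λ c α₁ : ℝ} (hκQ : 0 ≤ κQ) (hcF : 0 ≤ cF) (hcV : 0 ≤ cV)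
    (hκC : 0 ≤ κC) (hBG : 0 ≤ BG) (hBX : 0 ≤ BX) (hBE : 0 ≤ BE) (hBc : 0 ≤ Bc) (hBc' : 0 ≤ Bc')
    (hc : 0 ≤ c) (hα₁ : 0 ≤ α₁) : 0 ≤ kappa368 κQ cF cV κC BG BX BE Bc Bc' Λ c α₁ := by
  unfold kappa368
  positivity

omit [Fintype g.Site] [DecidableEq g.Site] in
/-- `κ₃₄₉ ≧ 0` (gen 6's constant) for non-negative constants. [cite: Balaban1985BackgroundPropagators, (3.49) p.399] -/
theorem kappa349_nonneg {κQ B₀ B₁ Λ c : ℝ} (hB₁ : 0 ≤ B₁) : 0 ≤ kappa349 κQ B₀ B₁ Λ c := by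
  unfold kappa349
  positivity

/-- **The five words of `P′(A)·D*`** (`B9Eq360Vprime.pPrime_explicit` multiplied by `D*` on the right and re-associated so
that words 1–4 end in the letter `G′(U′U)D*` and word 5 in the sub-word of §1), with a generic left end letter `X` (`X = G′`:
entry 3; `X = ∇G′`: entry 4): majorant `κ₃₆₈ᴰ·α₁·w_X(Lʲη)⁻⁴Lʲη·e^{−ρd}` for `ρ + 2(2α+β)δ₀ ≦ δ`.  INPUTS of printed shape as
in `B9Ineq368PPrime.hasMajorant_pPrime_words` ((3.42)₁ for `G′(U)`, the majorant of `X`; (3.48) at `U`, `U′U`;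
(3.57) with (3.59) and (3.19); the (3.63)-product `V′G′(U′U)`; (3.66) for `C′(A)`), PLUS: (3.42)₃ at `U′U` for `G′(U′U)D*`
(`hEDs`), (3.42)₃ at `U` for the divergence-form letter (`hGDv`), the divergence form of `V′` (`hV`, `hBpp`, `hCpp`), and the
scale transfers of `Lʲη`, `(Lʲη)⁻¹`, `(Lʲη)⁻²`, `(Lʲη)⁻⁴`.
[cite: Balaban1985BackgroundPropagators, (3.68) p.403 + (3.57)–(3.67) pp.401–403 + Thm 3.1/3.2 pp.397–398; Balaban1984PropagatorsII, Lemma 2.1 p.234] -/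
theorem hasMajorant_pPrime_words_Ds (blk : W → g.Site) (d : ℕ)
    (δ₀ δ α β ρ Λ κQ cF cV κC BG BG3 BX BE BE3 Bc Bc' cB cC α₁ : ℝ) (wX : g.Site → ℝ)
    (hwX : ∀ a, 0 ≤ wX a) (hκQ : 0 ≤ κQ) (hcF : 0 ≤ cF) (hcV : 0 ≤ cV) (hκC : 0 ≤ κC) (hBG : 0 ≤ BG)
    (hBG3 : 0 ≤ BG3) (hBX : 0 ≤ BX) (hBE : 0 ≤ BE) (hBE3 : 0 ≤ BE3) (hBc : 0 ≤ Bc) (hBc' : 0 ≤ Bc') (hcB : 0 ≤ cB)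
    (hcC : 0 ≤ cC) (hα₁ : 0 ≤ α₁) (hΛ : 1 ≤ Λ) (hρ : 0 ≤ ρ) (hα : 0 ≤ α) (hβ : 0 ≤ β) (hδ₀ : 0 ≤ δ₀)
    (hr : ρ + 2 * ((2 * α + β) * δ₀) ≤ δ)
    (hdnn : ∀ a b : g.Site, 0 ≤ g.dist a b) (htri : Triangle254 (toB6 g R H)) (hlen : ∀ y : g.Site, 0 < g.len y)
    (h261 : Ineq261 d (toB6 g R H) δ₀ β)
    (hT1 : ScaleTransfer g δ₀ α Λ (fun a => g.len a)) (hT1i : ScaleTransfer g δ₀ α Λ (fun a => (g.len a)⁻¹))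
    (hT2i : ScaleTransfer g δ₀ α Λ (fun a => (g.len a ^ 2)⁻¹)) (hT4 : ScaleTransfer g δ₀ α Λ (fun a => (g.len a ^ 4)⁻¹))
    {X G E V Qs Q Qs' Q' F₂ F₂s Cinv Cinv' Cp Ds Dv Bpp Cpp : Module.End ℝ (W → ℝ)}
    (h357 : Q' = Q + F₂) (h357s : Qs' = Qs + F₂s) (hV : V = Dv * Bpp + Cpp)
    (hX : HasMajorant (g := toB6 g R H) blk X (fun a b => BX * wX a * Real.exp (-(δ * g.dist a b))))
    (hG : HasMajorant (g := toB6 g R H) blk G (fun a b => BG * g.len a ^ 2 * Real.exp (-(δ * g.dist a b))))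
    (hGDv : HasMajorant (g := toB6 g R H) blk (G * Dv) (fun a b => BG3 * g.len a * Real.exp (-(δ * g.dist a b))))
    (hEDs : HasMajorant (g := toB6 g R H) blk (E * Ds) (fun a b => BE3 * g.len a * Real.exp (-(δ * g.dist a b))))
    (hVE : HasMajorant (g := toB6 g R H) blk (V * E) (fun a b => cV * α₁ * BE * Real.exp (-(δ * g.dist a b))))
    (hBpp : HasMajorant (g := toB6 g R H) blk Bpp (fun a b => cB * α₁ * (g.len a)⁻¹ * Real.exp (-(δ * g.dist a b))))
    (hCpp : HasMajorant (g := toB6 g R H) blk Cpp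
      (fun a b => cC * α₁ * (g.len a ^ 2)⁻¹ * Real.exp (-(δ * g.dist a b))))
    (hQ : HasMajorant (g := toB6 g R H) blk Q (fun a b : g.Site => if a = b then κQ else 0))
    (hQs : HasMajorant (g := toB6 g R H) blk Qs (fun a b : g.Site => if a = b then κQ else 0))
    (hF : HasMajorant (g := toB6 g R H) blk F₂ (fun a b : g.Site => if a = b then cF * α₁ else 0))
    (hFs : HasMajorant (g := toB6 g R H) blk F₂s (fun a b : g.Site => if a = b then cF * α₁ else 0))
    (hCinv : HasMajorant (g := toB6 g R H) blk Cinv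
      (fun a b => Bc * (g.len a ^ 4)⁻¹ * Real.exp (-(δ * g.dist a b))))
    (hCinv' : HasMajorant (g := toB6 g R H) blk Cinv'
      (fun a b => Bc' * (g.len a ^ 4)⁻¹ * Real.exp (-(δ * g.dist a b))))
    (hCp : HasMajorant (g := toB6 g R H) blk Cp
      (fun a b => κC * α₁ * g.len a ^ 4 * Real.exp (-(δ * g.dist a b)))) :
    HasMajorant (g := toB6 g R H) blk
      (X * V * E * Qs' * Cinv' * Q' * (E * Ds) + X * F₂s * Cinv' * Q' * (E * Ds)
        - X * Qs * (Cinv' * Cp * Cinv) * Q' * (E * Ds) + X * Qs * Cinv * F₂ * (E * Ds)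
        + X * Qs * Cinv * Q * (G * V * E * Ds))
      (fun a b => kappa368Ds κQ cF cV κC BG BG3 BX BE BE3 Bc Bc' cB cC Λ (B6.c1 d δ₀ β) α₁ * α₁ *
        (wX a * ((g.len a ^ 4)⁻¹ * g.len a)) * Real.exp (-(ρ * g.dist a b))) := by
  -- constants and rates
  set c : ℝ := B6.c1 d δ₀ β with hc_def
  have hc0 : 0 ≤ c := B6RandomWalk.c1_nonneg d δ₀ β
  have hw1 : ∀ a : g.Site, 0 ≤ g.len a := fun a => (hlen a).le
  have hw2 : ∀ a : g.Site, 0 ≤ g.len a ^ 2 := fun a => sq_nonneg _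
  have hw4p : ∀ a : g.Site, 0 ≤ g.len a ^ 4 := fun a => by positivity
  have hw4 : ∀ a : g.Site, 0 ≤ (g.len a ^ 4)⁻¹ := fun a => inv_nonneg.mpr (hw4p a)
  have hΛ0 : 0 ≤ Λ := zero_le_one.trans hΛ
  have hεnn : 0 ≤ (2 * α + β) * δ₀ := by positivity
  set r : ℝ := ρ + (2 * α + β) * δ₀ with hr_def
  have hρr : ρ ≤ r := by rw [hr_def]; linarith
  have hr0 : 0 ≤ r := hρ.trans hρr
  have hrδ : r + (2 * α + β) * δ₀ ≤ δ := by rw [hr_def]; linarith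
  have hrδ' : r ≤ δ := by linarith
  have hρδ : ρ ≤ δ := hρr.trans hrδ'
  have hρr' : ρ + (2 * α + β) * δ₀ ≤ r := le_of_eq hr_def.symm
  have hαδ : 0 ≤ 2 * α * δ₀ := by positivity
  have hcFα : 0 ≤ cF * α₁ := mul_nonneg hcF hα₁
  have hcVα : 0 ≤ cV * α₁ * BE := by positivity
  -- scale transfers at exponent 2α, constant Λ²: for the weight `Lʲη` of the right end letter and `(Lʲη)⁻⁴·Lʲη`
  obtain ⟨t1, t41⟩ := transfers_word (g := g) hw1 hΛ hα hδ₀ hdnn hT1 hT4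
  have t4 : ScaleTransfer g δ₀ (2 * α) (Λ ^ 2) (fun a => (g.len a ^ 4)⁻¹) := transfer_two (g := g) hw4 hΛ hα hδ₀ hdnn hT4
  -- weakened letters
  have hXr := hasMajorant_rate_mono (R := R) (H := H) blk BX wX hBX hwX hrδ' hdnn hX
  have hEDsρ := hasMajorant_rate_mono (R := R) (H := H) blk BE3 (fun a => g.len a) hBE3 hw1 hρδ hdnn hEDs
  have hCinvr := hasMajorant_rate_mono (R := R) (H := H) blk Bc (fun a => (g.len a ^ 4)⁻¹) hBc hw4 hrδ' hdnn hCinv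
  have hCinv'r := hasMajorant_rate_mono (R := R) (H := H) blk Bc' (fun a => (g.len a ^ 4)⁻¹) hBc' hw4 hrδ' hdnn
    hCinv'
  have hVEr : HasMajorant (g := toB6 g R H) blk (V * E) (fun a b => cV * α₁ * BE * Real.exp (-(r * g.dist a b))) :=
    hasMajorant_mono (g := toB6 g R H) blk hVE fun a b =>
      mul_le_mul_of_nonneg_left (Real.exp_le_exp.mpr (by nlinarith [hdnn a b])) hcVα
  -- the block-local letters Q′(U′U), Q′*(U′U) of (3.57)
  have hQ' : HasMajorant (g := toB6 g R H) blk Q' (fun a b : g.Site => if a = b then κQ + cF * α₁ else 0) := by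
    rw [h357]; exact hasMajorant_local_add (R := R) (H := H) blk κQ (cF * α₁) hQ hF
  have hQs' : HasMajorant (g := toB6 g R H) blk Qs' (fun a b : g.Site => if a = b then κQ + cF * α₁ else 0) := by
    rw [h357s]; exact hasMajorant_local_add (R := R) (H := H) blk κQ (cF * α₁) hQs hFs
  have hκ' : 0 ≤ κQ + cF * α₁ := add_nonneg hκQ hcFα
  -- W1 = (X·V′E)·Qs′·Cinv′·Q′·(E D*)
  have hA1 : HasMajorant (g := toB6 g R H) blk (X * V * E)
      (fun a b => (BX * (cV * α₁ * BE) * B6.c1 d δ₀ β) * wX a * Real.exp (-(r * g.dist a b))) := by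
    rw [mul_assoc]
    exact hasMajorant_comp_decay_right1 (R := R) (H := H) blk d δ₀ (2 * α) β r δ BX (cV * α₁ * BE) wX hwX hBX
      hcVα hr0 hαδ hrδ hdnn htri h261 hX hVEr
  have hW1 := hasMajorant_word5 (R := R) (H := H) blk d δ₀ (2 * α) β ρ r (Λ ^ 2) (κQ + cF * α₁) (κQ + cF * α₁)
    (BX * (cV * α₁ * BE) * B6.c1 d δ₀ β) Bc' BE3 wX (fun a => (g.len a ^ 4)⁻¹) (fun a => g.len a) hwX hw4 hw1
    hκ' hκ' (by positivity) hBc' hBE3 (by positivity) hρ hρr' hdnn htri h261 t1 t41 hA1 hQs' hCinv'r hQ' hEDsρ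
  -- W2 = X·F′₂*·Cinv′·Q′·(E D*)
  have hW2 := hasMajorant_word5 (R := R) (H := H) blk d δ₀ (2 * α) β ρ r (Λ ^ 2) (cF * α₁) (κQ + cF * α₁)
    BX Bc' BE3 wX (fun a => (g.len a ^ 4)⁻¹) (fun a => g.len a) hwX hw4 hw1
    hcFα hκ' hBX hBc' hBE3 (by positivity) hρ hρr' hdnn htri h261 t1 t41 hXr hFs hCinv'r hQ' hEDsρ
  -- W3 = X·Q′*·(Cinv′·C′·Cinv)·Q′·(E D*)
  have u1 : HasMajorant (g := toB6 g R H) blk (Cp * Cinv)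
      (fun a b => (κC * α₁ * Bc * Λ ^ 2 * B6.c1 d δ₀ β) * (g.len a ^ 4 * (g.len a ^ 4)⁻¹) *
        Real.exp (-(r * g.dist a b))) :=
    hasMajorant_comp_decay (R := R) (H := H) blk d δ₀ (2 * α) β r δ (Λ ^ 2) (κC * α₁) Bc (fun a => g.len a ^ 4)
      (fun a => (g.len a ^ 4)⁻¹) hw4p hw4 (by positivity) (mul_nonneg hκC hα₁) hBc hr0 hrδ hdnn htri t4 h261 hCp
      hCinvr
  have u1' : HasMajorant (g := toB6 g R H) blk (Cp * Cinv)
      (fun a b => (κC * α₁ * Bc * Λ ^ 2 * B6.c1 d δ₀ β) * Real.exp (-(r * g.dist a b))) := by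
    refine hasMajorant_mono (g := toB6 g R H) blk u1 fun a b => le_of_eq ?_
    have ha : g.len a ≠ 0 := (hlen a).ne'
    field_simp
  have u3 : HasMajorant (g := toB6 g R H) blk (Cinv' * (Cp * Cinv))
      (fun a b => (Bc' * (κC * α₁ * Bc * Λ ^ 2 * B6.c1 d δ₀ β) * B6.c1 d δ₀ β) * (g.len a ^ 4)⁻¹ *
        Real.exp (-(r * g.dist a b))) :=
    hasMajorant_comp_decay_right1 (R := R) (H := H) blk d δ₀ (2 * α) β r δ Bc' (κC * α₁ * Bc * Λ ^ 2 * B6.c1 d δ₀ β)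
      (fun a => (g.len a ^ 4)⁻¹) hw4 hBc' (by positivity) hr0 hαδ hrδ hdnn htri h261 hCinv' u1'
  have hC3 : HasMajorant (g := toB6 g R H) blk (Cinv' * Cp * Cinv)
      (fun a b => (Bc' * (κC * α₁ * Bc * Λ ^ 2 * B6.c1 d δ₀ β) * B6.c1 d δ₀ β) * (g.len a ^ 4)⁻¹ *
        Real.exp (-(r * g.dist a b))) := by
    rw [mul_assoc]; exact u3
  have hW3 := hasMajorant_word5 (R := R) (H := H) blk d δ₀ (2 * α) β ρ r (Λ ^ 2) κQ (κQ + cF * α₁)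
    BX (Bc' * (κC * α₁ * Bc * Λ ^ 2 * B6.c1 d δ₀ β) * B6.c1 d δ₀ β) BE3 wX (fun a => (g.len a ^ 4)⁻¹)
    (fun a => g.len a) hwX hw4 hw1 hκQ hκ' hBX (by positivity) hBE3 (by positivity) hρ hρr' hdnn htri h261 t1 t41
    hXr hQs hC3 hQ' hEDsρ
  -- W4 = X·Q′*·Cinv·F′₂·(E D*)
  have hW4 := hasMajorant_word5 (R := R) (H := H) blk d δ₀ (2 * α) β ρ r (Λ ^ 2) κQ (cF * α₁)
    BX Bc BE3 wX (fun a => (g.len a ^ 4)⁻¹) (fun a => g.len a) hwX hw4 hw1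
    hκQ hcFα hBX hBc hBE3 (by positivity) hρ hρr' hdnn htri h261 t1 t41 hXr hQs hCinvr hF hEDsρ
  -- W5 = X·Q′*·Cinv·Q′·(G′V′E D*), the bracket by §1
  have hB5 := hasMajorant_GVEDs (R := R) (H := H) blk d δ₀ δ α β ρ Λ BG BG3 BE3 cB cC α₁ hBG hBG3 hBE3 hcB hcC hα₁
    hΛ hρ hα hβ hδ₀ hr hdnn htri hlen h261 hT1 hT1i hT2i hV hG hGDv hEDs hBpp hCpp
  have hW5 := hasMajorant_word5 (R := R) (H := H) blk d δ₀ (2 * α) β ρ r (Λ ^ 2) κQ κQ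
    BX Bc (α₁ * BE3 * Λ ^ 4 * B6.c1 d δ₀ β ^ 2 * (BG3 * cB + BG * cC)) wX (fun a => (g.len a ^ 4)⁻¹)
    (fun a => g.len a) hwX hw4 hw1 hκQ hκQ hBX hBc (by positivity) (by positivity) hρ hρr' hdnn htri h261 t1 t41 hXr
    hQs hCinvr hQ hB5
  -- the signed sum
  have hsum := hasMajorant_add (g := toB6 g R H) blk (hasMajorant_add (g := toB6 g R H) blk
    (hasMajorant_sub (R := R) (H := H) blk (hasMajorant_add (g := toB6 g R H) blk hW1 hW2) hW3) hW4) hW5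
  refine hasMajorant_mono (g := toB6 g R H) blk hsum fun a b => le_of_eq ?_
  simp only [kappa368Ds]
  ring

/-! ## §3  (3.68), entries 3 and 4, in block-majorant (operator) form -/

/-- **(3.68) p. 403, third entry `|(P′(A)D*)_ν(x,x′)| ≦ O(1)α₁(Lʲη)⁻¹(…)`, block-majorant form** — for
`P′(A) = B9Eq360Vprime.pPrime G E Qs Qs' Cinv Cinv' Q Q'` given the expansions (3.57) (`h357`, `h357s`), (3.65)₁ (`h365`) and
(3.67) in resolvent form (`hC`), exactly as in gen 6's `ineq368_op`, PLUS the right-entry inputs of §2: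
`P′(A)·D* ≺ κ₃₆₈ᴰ(B_X = B_G)·α₁·(Lʲη)⁻¹·e^{−ρ d(y,y′)}` for `ρ + 2(2α+β)δ₀ ≦ δ`.
[cite: Balaban1985BackgroundPropagators, (3.68) p.403 + (3.42) p.397 + p.398 remarks + (3.57)–(3.67) pp.401–403; Balaban1984PropagatorsII, Lemma 2.1 p.234] -/
theorem ineq368_op_Ds (blk : W → g.Site) (d : ℕ) (δ₀ δ α β ρ Λ κQ cF cV κC BG BG3 BE BE3 Bc Bc' cB cC α₁ : ℝ)
    (hκQ : 0 ≤ κQ) (hcF : 0 ≤ cF) (hcV : 0 ≤ cV) (hκC : 0 ≤ κC) (hBG : 0 ≤ BG) (hBG3 : 0 ≤ BG3) (hBE : 0 ≤ BE)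
    (hBE3 : 0 ≤ BE3) (hBc : 0 ≤ Bc) (hBc' : 0 ≤ Bc') (hcB : 0 ≤ cB) (hcC : 0 ≤ cC) (hα₁ : 0 ≤ α₁) (hΛ : 1 ≤ Λ)
    (hρ : 0 ≤ ρ) (hα : 0 ≤ α) (hβ : 0 ≤ β) (hδ₀ : 0 ≤ δ₀) (hr : ρ + 2 * ((2 * α + β) * δ₀) ≤ δ)
    (hdnn : ∀ a b : g.Site, 0 ≤ g.dist a b) (htri : Triangle254 (toB6 g R H)) (hlen : ∀ y : g.Site, 0 < g.len y)
    (h261 : Ineq261 d (toB6 g R H) δ₀ β)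
    (hT1 : ScaleTransfer g δ₀ α Λ (fun a => g.len a)) (hT1i : ScaleTransfer g δ₀ α Λ (fun a => (g.len a)⁻¹))
    (hT2i : ScaleTransfer g δ₀ α Λ (fun a => (g.len a ^ 2)⁻¹)) (hT4 : ScaleTransfer g δ₀ α Λ (fun a => (g.len a ^ 4)⁻¹))
    {G E V Qs Q Qs' Q' F₂ F₂s Cinv Cinv' Cp Ds Dv Bpp Cpp : Module.End ℝ (W → ℝ)}
    (h357 : Q' = Q + F₂) (h357s : Qs' = Qs + F₂s) (h365 : E = G + G * V * E)
    (hC : Cinv' - Cinv = -(Cinv' * Cp * Cinv)) (hV : V = Dv * Bpp + Cpp)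
    (hG : HasMajorant (g := toB6 g R H) blk G (fun a b => BG * g.len a ^ 2 * Real.exp (-(δ * g.dist a b))))
    (hGDv : HasMajorant (g := toB6 g R H) blk (G * Dv) (fun a b => BG3 * g.len a * Real.exp (-(δ * g.dist a b))))
    (hEDs : HasMajorant (g := toB6 g R H) blk (E * Ds) (fun a b => BE3 * g.len a * Real.exp (-(δ * g.dist a b))))
    (hVE : HasMajorant (g := toB6 g R H) blk (V * E) (fun a b => cV * α₁ * BE * Real.exp (-(δ * g.dist a b))))
    (hBpp : HasMajorant (g := toB6 g R H) blk Bpp (fun a b => cB * α₁ * (g.len a)⁻¹ * Real.exp (-(δ * g.dist a b))))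
    (hCpp : HasMajorant (g := toB6 g R H) blk Cpp
      (fun a b => cC * α₁ * (g.len a ^ 2)⁻¹ * Real.exp (-(δ * g.dist a b))))
    (hQ : HasMajorant (g := toB6 g R H) blk Q (fun a b : g.Site => if a = b then κQ else 0))
    (hQs : HasMajorant (g := toB6 g R H) blk Qs (fun a b : g.Site => if a = b then κQ else 0))
    (hF : HasMajorant (g := toB6 g R H) blk F₂ (fun a b : g.Site => if a = b then cF * α₁ else 0))
    (hFs : HasMajorant (g := toB6 g R H) blk F₂s (fun a b : g.Site => if a = b then cF * α₁ else 0))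
    (hCinv : HasMajorant (g := toB6 g R H) blk Cinv
      (fun a b => Bc * (g.len a ^ 4)⁻¹ * Real.exp (-(δ * g.dist a b))))
    (hCinv' : HasMajorant (g := toB6 g R H) blk Cinv'
      (fun a b => Bc' * (g.len a ^ 4)⁻¹ * Real.exp (-(δ * g.dist a b))))
    (hCp : HasMajorant (g := toB6 g R H) blk Cp
      (fun a b => κC * α₁ * g.len a ^ 4 * Real.exp (-(δ * g.dist a b)))) :
    HasMajorant (g := toB6 g R H) blk (B9Eq360Vprime.pPrime G E Qs Qs' Cinv Cinv' Q Q' * Ds)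
      (fun a b => kappa368Ds κQ cF cV κC BG BG3 BG BE BE3 Bc Bc' cB cC Λ (B6.c1 d δ₀ β) α₁ * α₁ * (g.len a)⁻¹ *
        Real.exp (-(ρ * g.dist a b))) := by
  have hw2 : ∀ a : g.Site, 0 ≤ g.len a ^ 2 := fun a => sq_nonneg _
  rw [B9Eq360Vprime.pPrime_explicit G E Qs Qs' Cinv Cinv' Q Q' V F₂ F₂s Cp h365 h357 h357s hC]
  have e : (G * V * E * Qs' * Cinv' * Q' * E + G * F₂s * Cinv' * Q' * E - G * Qs * (Cinv' * Cp * Cinv) * Q' * E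
        + G * Qs * Cinv * F₂ * E + G * Qs * Cinv * Q * (G * V * E)) * Ds
      = G * V * E * Qs' * Cinv' * Q' * (E * Ds) + G * F₂s * Cinv' * Q' * (E * Ds)
        - G * Qs * (Cinv' * Cp * Cinv) * Q' * (E * Ds) + G * Qs * Cinv * F₂ * (E * Ds)
        + G * Qs * Cinv * Q * (G * V * E * Ds) := by
    simp only [add_mul, sub_mul, mul_assoc]
  rw [e]
  have h := hasMajorant_pPrime_words_Ds (R := R) (H := H) blk d δ₀ δ α β ρ Λ κQ cF cV κC BG BG3 BG BE BE3 Bc Bc' cB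
    cC α₁ (fun a => g.len a ^ 2) hw2 hκQ hcF hcV hκC hBG hBG3 hBG hBE hBE3 hBc hBc' hcB hcC hα₁ hΛ hρ hα hβ hδ₀ hr
    hdnn htri hlen h261 hT1 hT1i hT2i hT4 h357 h357s hV hG hG hGDv hEDs hVE hBpp hCpp hQ hQs hF hFs hCinv hCinv' hCp
  refine hasMajorant_mono (g := toB6 g R H) blk h fun a b => le_of_eq ?_
  have ha : g.len a ≠ 0 := (hlen a).ne'
  field_simp

/-- **(3.68) p. 403, fourth entry `|(DP′(A)D*)_{μν}(x,x′)| ≦ O(1)α₁(Lʲη)⁻²(…)`, block-majorant form**: the same words with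
the left end letter `∇G′(U)` ((3.42)₂-majorant `B_DLʲη e^{−δd}`, `hDG`): `D·P′(A)·D* ≺ κ₃₆₈ᴰ(B_X = B_D)·α₁·(Lʲη)⁻²·e^{−ρd}`.
[cite: Balaban1985BackgroundPropagators, (3.68) p.403 + (3.42) p.397 + p.398 remarks; Balaban1984PropagatorsII, Lemma 2.1 p.234] -/
theorem ineq368_op_DDs (blk : W → g.Site) (d : ℕ) (δ₀ δ α β ρ Λ κQ cF cV κC BG BG3 BD BE BE3 Bc Bc' cB cC α₁ : ℝ)
    (hκQ : 0 ≤ κQ) (hcF : 0 ≤ cF) (hcV : 0 ≤ cV) (hκC : 0 ≤ κC) (hBG : 0 ≤ BG) (hBG3 : 0 ≤ BG3) (hBD : 0 ≤ BD)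
    (hBE : 0 ≤ BE) (hBE3 : 0 ≤ BE3) (hBc : 0 ≤ Bc) (hBc' : 0 ≤ Bc') (hcB : 0 ≤ cB) (hcC : 0 ≤ cC) (hα₁ : 0 ≤ α₁)
    (hΛ : 1 ≤ Λ) (hρ : 0 ≤ ρ) (hα : 0 ≤ α) (hβ : 0 ≤ β) (hδ₀ : 0 ≤ δ₀) (hr : ρ + 2 * ((2 * α + β) * δ₀) ≤ δ)
    (hdnn : ∀ a b : g.Site, 0 ≤ g.dist a b) (htri : Triangle254 (toB6 g R H)) (hlen : ∀ y : g.Site, 0 < g.len y)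
    (h261 : Ineq261 d (toB6 g R H) δ₀ β)
    (hT1 : ScaleTransfer g δ₀ α Λ (fun a => g.len a)) (hT1i : ScaleTransfer g δ₀ α Λ (fun a => (g.len a)⁻¹))
    (hT2i : ScaleTransfer g δ₀ α Λ (fun a => (g.len a ^ 2)⁻¹)) (hT4 : ScaleTransfer g δ₀ α Λ (fun a => (g.len a ^ 4)⁻¹))
    {G D E V Qs Q Qs' Q' F₂ F₂s Cinv Cinv' Cp Ds Dv Bpp Cpp : Module.End ℝ (W → ℝ)}
    (h357 : Q' = Q + F₂) (h357s : Qs' = Qs + F₂s) (h365 : E = G + G * V * E)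
    (hC : Cinv' - Cinv = -(Cinv' * Cp * Cinv)) (hV : V = Dv * Bpp + Cpp)
    (hG : HasMajorant (g := toB6 g R H) blk G (fun a b => BG * g.len a ^ 2 * Real.exp (-(δ * g.dist a b))))
    (hDG : HasMajorant (g := toB6 g R H) blk (D * G) (fun a b => BD * g.len a * Real.exp (-(δ * g.dist a b))))
    (hGDv : HasMajorant (g := toB6 g R H) blk (G * Dv) (fun a b => BG3 * g.len a * Real.exp (-(δ * g.dist a b))))
    (hEDs : HasMajorant (g := toB6 g R H) blk (E * Ds) (fun a b => BE3 * g.len a * Real.exp (-(δ * g.dist a b))))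
    (hVE : HasMajorant (g := toB6 g R H) blk (V * E) (fun a b => cV * α₁ * BE * Real.exp (-(δ * g.dist a b))))
    (hBpp : HasMajorant (g := toB6 g R H) blk Bpp (fun a b => cB * α₁ * (g.len a)⁻¹ * Real.exp (-(δ * g.dist a b))))
    (hCpp : HasMajorant (g := toB6 g R H) blk Cpp
      (fun a b => cC * α₁ * (g.len a ^ 2)⁻¹ * Real.exp (-(δ * g.dist a b))))
    (hQ : HasMajorant (g := toB6 g R H) blk Q (fun a b : g.Site => if a = b then κQ else 0))
    (hQs : HasMajorant (g := toB6 g R H) blk Qs (fun a b : g.Site => if a = b then κQ else 0))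
    (hF : HasMajorant (g := toB6 g R H) blk F₂ (fun a b : g.Site => if a = b then cF * α₁ else 0))
    (hFs : HasMajorant (g := toB6 g R H) blk F₂s (fun a b : g.Site => if a = b then cF * α₁ else 0))
    (hCinv : HasMajorant (g := toB6 g R H) blk Cinv
      (fun a b => Bc * (g.len a ^ 4)⁻¹ * Real.exp (-(δ * g.dist a b))))
    (hCinv' : HasMajorant (g := toB6 g R H) blk Cinv'
      (fun a b => Bc' * (g.len a ^ 4)⁻¹ * Real.exp (-(δ * g.dist a b))))
    (hCp : HasMajorant (g := toB6 g R H) blk Cp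
      (fun a b => κC * α₁ * g.len a ^ 4 * Real.exp (-(δ * g.dist a b)))) :
    HasMajorant (g := toB6 g R H) blk (D * B9Eq360Vprime.pPrime G E Qs Qs' Cinv Cinv' Q Q' * Ds)
      (fun a b => kappa368Ds κQ cF cV κC BG BG3 BD BE BE3 Bc Bc' cB cC Λ (B6.c1 d δ₀ β) α₁ * α₁ * (g.len a ^ 2)⁻¹ *
        Real.exp (-(ρ * g.dist a b))) := by
  have hw1 : ∀ a : g.Site, 0 ≤ g.len a := fun a => (hlen a).le
  rw [B9Eq360Vprime.pPrime_explicit G E Qs Qs' Cinv Cinv' Q Q' V F₂ F₂s Cp h365 h357 h357s hC]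
  have e : D * (G * V * E * Qs' * Cinv' * Q' * E + G * F₂s * Cinv' * Q' * E - G * Qs * (Cinv' * Cp * Cinv) * Q' * E
        + G * Qs * Cinv * F₂ * E + G * Qs * Cinv * Q * (G * V * E)) * Ds
      = D * G * V * E * Qs' * Cinv' * Q' * (E * Ds) + D * G * F₂s * Cinv' * Q' * (E * Ds)
        - D * G * Qs * (Cinv' * Cp * Cinv) * Q' * (E * Ds) + D * G * Qs * Cinv * F₂ * (E * Ds)
        + D * G * Qs * Cinv * Q * (G * V * E * Ds) := by
    simp only [add_mul, sub_mul, mul_add, mul_sub, mul_assoc]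
  rw [e]
  have h := hasMajorant_pPrime_words_Ds (R := R) (H := H) blk d δ₀ δ α β ρ Λ κQ cF cV κC BG BG3 BD BE BE3 Bc Bc' cB
    cC α₁ (fun a => g.len a) hw1 hκQ hcF hcV hκC hBG hBG3 hBD hBE hBE3 hBc hBc' hcB hcC hα₁ hΛ hρ hα hβ hδ₀ hr
    hdnn htri hlen h261 hT1 hT1i hT2i hT4 h357 h357s hV hDG hG hGDv hEDs hVE hBpp hCpp hQ hQs hF hFs hCinv hCinv' hCp
  refine hasMajorant_mono (g := toB6 g R H) blk h fun a b => le_of_eq ?_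
  have ha : g.len a ≠ 0 := (hlen a).ne'
  field_simp

/-! ## §4  (3.77) with all four (3.68)-entries and the three (3.49)-entries discharged -/

/-- **(3.77) from Theorem-3.1/3.2-shaped inputs and the Sect. B structural letters only** — `P₁(A) =
B9Eq386Neumann.pOne D D′ D* D′* P(U) P′(A)` with `P(U) = B9Eq360Vprime.pOp G Qs Cinv Q` ((3.25)) and `P′(A) =
B9Eq360Vprime.pPrime G E Qs Qs' Cinv Cinv' Q Q'` ((3.68)); ALL SEVEN entry hypotheses of `B9Ineq377POne.ineq377_op`
DISCHARGED: `P`, `D·P`, `P·D*` by `B9Ineq368PPrime.ineq349_op`; `P′`, `D·P′` by `ineq368_op`, `ineq368_op_D`; `P′·D*`,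
`D·P′·D*` by `ineq368_op_Ds`, `ineq368_op_DDs` (§3).  INPUTS: Theorem 3.1 at `U` with its single constant `B₀` — (3.42)₁
`G′ ≺ B₀(Lʲη)²e^{−δd}` (`hG`), (3.42)₂ `∇G′` (`hDG`), (3.42)₃ `G′∇*` (`hGDs`) and `G′∇♯` for the divergence-form letter (`hGDv`;
«we may always replace ∇_U by ∇*_U», p. 398); (3.42)₁,₃ for `G′(U′U)` (`hE`, `hEDs`; p. 403 l. 1–9); (3.48) at `U`, `U′U`
(`hCinv`, `hCinv'`); the (3.63)-product `V′G′(U′U)` (`hVE`); the divergence form of `V′` (`hV`, `hBpp`, `hCpp`); (3.57) with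
(3.59)/(3.19) (`h357`, `h357s`, `hQ`, `hQs`, `hF`, `hFs`); (3.65)₁ (`h365`); (3.67) (`hC`) with (3.66) (`hCp`); the first-order
letters `K = D_{U′U} − D_U`, `K* = D*_{U′U} − D*_U` (`hD'`, `hDs'`, `hK`, `hKs`; (3.70)/(3.74) + (3.37)); the scale transfers of
`Lʲη`, `(Lʲη)²`, `(Lʲη)⁻¹`, `(Lʲη)⁻²`, `(Lʲη)⁻⁴` and Lemma 2.1 of [4].  RATES: inputs at `δ`; the (3.49)/(3.68) step at `ρ₂`
with `ρ₂ + 2(2α+β)δ₀ ≦ δ`; conclusion at `ρ` with `ρ + 2(α+β)δ₀ ≦ ρ₂`.  CONSTANT: `κ₃₇₇(c_K, κ₃₄₉, κ_{P′})` of `B9Ineq377POne`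
with `κ_{P′} = 2(κ₃₆₈ + κ₃₆₈ᴰ)` (entries 1/2 resp. 3/4 share their constants when `B_X = B₀`; each entry's majorant is
weakened to the common `κ_{P′}`).
[cite: Balaban1985BackgroundPropagators, (3.76)–(3.77) pp.405–406 + (3.68) p.403 + (3.49) p.399 + Thm 3.1/3.2 pp.397–398 + (3.57)–(3.67) pp.401–403; Balaban1984PropagatorsII, Lemma 2.1 p.234] -/
theorem ineq377_op_of_349_368 (blk : W → g.Site) (d : ℕ)
    (δ₀ δ α β ρ₂ ρ Λ κQ cF cV κC B₀ BE BE3 Bc Bc' cB cC cK α₁ : ℝ)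
    (hκQ : 0 ≤ κQ) (hcF : 0 ≤ cF) (hcV : 0 ≤ cV) (hκC : 0 ≤ κC) (hB₀ : 0 ≤ B₀) (hBE : 0 ≤ BE) (hBE3 : 0 ≤ BE3)
    (hBc : 0 ≤ Bc) (hBc' : 0 ≤ Bc') (hcB : 0 ≤ cB) (hcC : 0 ≤ cC) (hcK : 0 ≤ cK) (hα₁ : 0 ≤ α₁) (hΛ : 1 ≤ Λ)
    (hρ : 0 ≤ ρ) (hα : 0 ≤ α) (hβ : 0 ≤ β) (hδ₀ : 0 ≤ δ₀)
    (hr₂ : ρ₂ + 2 * ((2 * α + β) * δ₀) ≤ δ) (hr : ρ + 2 * ((α + β) * δ₀) ≤ ρ₂)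
    (hdnn : ∀ a b : g.Site, 0 ≤ g.dist a b) (htri : Triangle254 (toB6 g R H)) (hlen : ∀ y : g.Site, 0 < g.len y)
    (h261 : Ineq261 d (toB6 g R H) δ₀ β)
    (hT1 : ScaleTransfer g δ₀ α Λ (fun a => g.len a)) (hT2 : ScaleTransfer g δ₀ α Λ (fun a => g.len a ^ 2))
    (hT1i : ScaleTransfer g δ₀ α Λ (fun a => (g.len a)⁻¹)) (hT2i : ScaleTransfer g δ₀ α Λ (fun a => (g.len a ^ 2)⁻¹))
    (hT4 : ScaleTransfer g δ₀ α Λ (fun a => (g.len a ^ 4)⁻¹))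
    {G D Ds D' Ds' K Ks E V Qs Q Qs' Q' F₂ F₂s Cinv Cinv' Cp Dv Bpp Cpp : Module.End ℝ (W → ℝ)}
    (hD' : D' = D + K) (hDs' : Ds' = Ds + Ks)
    (h357 : Q' = Q + F₂) (h357s : Qs' = Qs + F₂s) (h365 : E = G + G * V * E)
    (hC : Cinv' - Cinv = -(Cinv' * Cp * Cinv)) (hV : V = Dv * Bpp + Cpp)
    (hG : HasMajorant (g := toB6 g R H) blk G (fun a b => B₀ * g.len a ^ 2 * Real.exp (-(δ * g.dist a b))))
    (hDG : HasMajorant (g := toB6 g R H) blk (D * G) (fun a b => B₀ * g.len a * Real.exp (-(δ * g.dist a b))))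
    (hGDs : HasMajorant (g := toB6 g R H) blk (G * Ds) (fun a b => B₀ * g.len a * Real.exp (-(δ * g.dist a b))))
    (hGDv : HasMajorant (g := toB6 g R H) blk (G * Dv) (fun a b => B₀ * g.len a * Real.exp (-(δ * g.dist a b))))
    (hE : HasMajorant (g := toB6 g R H) blk E (fun a b => BE * g.len a ^ 2 * Real.exp (-(δ * g.dist a b))))
    (hEDs : HasMajorant (g := toB6 g R H) blk (E * Ds) (fun a b => BE3 * g.len a * Real.exp (-(δ * g.dist a b))))
    (hVE : HasMajorant (g := toB6 g R H) blk (V * E) (fun a b => cV * α₁ * BE * Real.exp (-(δ * g.dist a b))))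
    (hBpp : HasMajorant (g := toB6 g R H) blk Bpp (fun a b => cB * α₁ * (g.len a)⁻¹ * Real.exp (-(δ * g.dist a b))))
    (hCpp : HasMajorant (g := toB6 g R H) blk Cpp
      (fun a b => cC * α₁ * (g.len a ^ 2)⁻¹ * Real.exp (-(δ * g.dist a b))))
    (hQ : HasMajorant (g := toB6 g R H) blk Q (fun a b : g.Site => if a = b then κQ else 0))
    (hQs : HasMajorant (g := toB6 g R H) blk Qs (fun a b : g.Site => if a = b then κQ else 0))
    (hF : HasMajorant (g := toB6 g R H) blk F₂ (fun a b : g.Site => if a = b then cF * α₁ else 0))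
    (hFs : HasMajorant (g := toB6 g R H) blk F₂s (fun a b : g.Site => if a = b then cF * α₁ else 0))
    (hCinv : HasMajorant (g := toB6 g R H) blk Cinv
      (fun a b => Bc * (g.len a ^ 4)⁻¹ * Real.exp (-(δ * g.dist a b))))
    (hCinv' : HasMajorant (g := toB6 g R H) blk Cinv'
      (fun a b => Bc' * (g.len a ^ 4)⁻¹ * Real.exp (-(δ * g.dist a b))))
    (hCp : HasMajorant (g := toB6 g R H) blk Cp
      (fun a b => κC * α₁ * g.len a ^ 4 * Real.exp (-(δ * g.dist a b))))
    (hK : HasMajorant (g := toB6 g R H) blk K (fun a b => cK * α₁ * (g.len a)⁻¹ * Real.exp (-(δ * g.dist a b))))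
    (hKs : HasMajorant (g := toB6 g R H) blk Ks (fun a b => cK * α₁ * (g.len a)⁻¹ * Real.exp (-(δ * g.dist a b)))) :
    HasMajorant (g := toB6 g R H) blk
      (pOne D D' Ds Ds' (B9Eq360Vprime.pOp G Qs Cinv Q) (B9Eq360Vprime.pPrime G E Qs Qs' Cinv Cinv' Q Q'))
      (fun a b => kappa377 cK (kappa349 κQ B₀ Bc Λ (B6.c1 d δ₀ β))
        (2 * (kappa368 κQ cF cV κC B₀ B₀ BE Bc Bc' Λ (B6.c1 d δ₀ β) α₁
          + kappa368Ds κQ cF cV κC B₀ B₀ B₀ BE BE3 Bc Bc' cB cC Λ (B6.c1 d δ₀ β) α₁))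
        Λ (B6.c1 d δ₀ β) α₁ * α₁ * (g.len a ^ 2)⁻¹ * Real.exp (-(ρ * g.dist a b))) := by
  -- names for the constants
  set c : ℝ := B6.c1 d δ₀ β with hc_def
  have hc0 : 0 ≤ c := B6RandomWalk.c1_nonneg d δ₀ β
  have hΛ0 : 0 ≤ Λ := zero_le_one.trans hΛ
  set k1 : ℝ := kappa368 κQ cF cV κC B₀ B₀ BE Bc Bc' Λ c α₁ with hk1
  set k3 : ℝ := kappa368Ds κQ cF cV κC B₀ B₀ B₀ BE BE3 Bc Bc' cB cC Λ c α₁ with hk3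
  have hk1n : 0 ≤ k1 := kappa368_nonneg hκQ hcF hcV hκC hB₀ hB₀ hBE hBc hBc' hc0 hα₁
  have hk3n : 0 ≤ k3 := kappa368Ds_nonneg hκQ hcF hcV hκC hB₀ hB₀ hB₀ hBE hBE3 hBc hBc' hcB hcC hc0 hα₁
  set kP' : ℝ := 2 * (k1 + k3) with hkP'
  have hkP'n : 0 ≤ kP' := by positivity
  have h1le : k1 ≤ kP' := by rw [hkP']; linarith
  have h3le : k3 ≤ kP' := by rw [hkP']; linarith
  -- rates
  have hε : 0 ≤ (2 * α + β) * δ₀ := by positivity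
  have hε' : 0 ≤ (α + β) * δ₀ := by positivity
  have hρ₂ : 0 ≤ ρ₂ := by linarith
  have hr₂' : ρ₂ + (2 * α + β) * δ₀ ≤ δ := by linarith
  have hρ₂δ : ρ₂ ≤ δ := by linarith
  have hw1i : ∀ a : g.Site, 0 ≤ (g.len a)⁻¹ := fun a => inv_nonneg.mpr (hlen a).le
  have hw2i : ∀ a : g.Site, 0 ≤ (g.len a ^ 2)⁻¹ := fun a => inv_nonneg.mpr (sq_nonneg _)
  -- (3.49) at rate ρ₂
  obtain ⟨hP, hDP, hPDs, -⟩ := B9Ineq368PPrime.ineq349_op (R := R) (H := H) blk d δ₀ δ α β ρ₂ Λ κQ B₀ Bc hκQ hB₀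
    hBc hΛ hρ₂ hα hβ hδ₀ hr₂' hdnn htri hlen h261 hT1 hT2 hT4 hQ hQs hG hDG hGDs hCinv
  -- (3.68) entries at rate ρ₂, each weakened to the common constant κ_{P′}
  have e1 := B9Ineq368PPrime.ineq368_op (R := R) (H := H) blk d δ₀ δ α β ρ₂ Λ κQ cF cV κC B₀ BE Bc Bc' α₁ hκQ hcF
    hcV hκC hB₀ hBE hBc hBc' hα₁ hΛ hρ₂ hα hβ hδ₀ hr₂ hdnn htri hlen h261 hT2 hT4 h357 h357s h365 hC hG hE hVE hQ hQs
    hF hFs hCinv hCinv' hCp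
  have e2 := B9Ineq368PPrime.ineq368_op_D (R := R) (H := H) blk d δ₀ δ α β ρ₂ Λ κQ cF cV κC B₀ B₀ BE Bc Bc' α₁ hκQ
    hcF hcV hκC hB₀ hB₀ hBE hBc hBc' hα₁ hΛ hρ₂ hα hβ hδ₀ hr₂ hdnn htri hlen h261 hT2 hT4 h357 h357s h365 hC hG hDG hE
    hVE hQ hQs hF hFs hCinv hCinv' hCp
  have e3 := ineq368_op_Ds (R := R) (H := H) blk d δ₀ δ α β ρ₂ Λ κQ cF cV κC B₀ B₀ BE BE3 Bc Bc' cB cC α₁ hκQ hcF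
    hcV hκC hB₀ hB₀ hBE hBE3 hBc hBc' hcB hcC hα₁ hΛ hρ₂ hα hβ hδ₀ hr₂ hdnn htri hlen h261 hT1 hT1i hT2i hT4 h357
    h357s h365 hC hV hG hGDv hEDs hVE hBpp hCpp hQ hQs hF hFs hCinv hCinv' hCp
  have e4 := ineq368_op_DDs (R := R) (H := H) blk d δ₀ δ α β ρ₂ Λ κQ cF cV κC B₀ B₀ B₀ BE BE3 Bc Bc' cB cC α₁ hκQ
    hcF hcV hκC hB₀ hB₀ hB₀ hBE hBE3 hBc hBc' hcB hcC hα₁ hΛ hρ₂ hα hβ hδ₀ hr₂ hdnn htri hlen h261 hT1 hT1i hT2i hT4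
    h357 h357s h365 hC hV hG hDG hGDv hEDs hVE hBpp hCpp hQ hQs hF hFs hCinv hCinv' hCp
  have hPp : HasMajorant (g := toB6 g R H) blk (B9Eq360Vprime.pPrime G E Qs Qs' Cinv Cinv' Q Q')
      (fun a b => kP' * α₁ * Real.exp (-(ρ₂ * g.dist a b))) :=
    hasMajorant_mono (g := toB6 g R H) blk e1 fun a b =>
      mul_le_mul_of_nonneg_right (mul_le_mul_of_nonneg_right h1le hα₁) (Real.exp_nonneg _)
  have hDPp : HasMajorant (g := toB6 g R H) blk (D * B9Eq360Vprime.pPrime G E Qs Qs' Cinv Cinv' Q Q')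
      (fun a b => kP' * α₁ * (g.len a)⁻¹ * Real.exp (-(ρ₂ * g.dist a b))) :=
    hasMajorant_mono (g := toB6 g R H) blk e2 fun a b =>
      mul_le_mul_of_nonneg_right (mul_le_mul_of_nonneg_right (mul_le_mul_of_nonneg_right h1le hα₁) (hw1i a))
        (Real.exp_nonneg _)
  have hPpDs : HasMajorant (g := toB6 g R H) blk (B9Eq360Vprime.pPrime G E Qs Qs' Cinv Cinv' Q Q' * Ds)
      (fun a b => kP' * α₁ * (g.len a)⁻¹ * Real.exp (-(ρ₂ * g.dist a b))) :=
    hasMajorant_mono (g := toB6 g R H) blk e3 fun a b =>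
      mul_le_mul_of_nonneg_right (mul_le_mul_of_nonneg_right (mul_le_mul_of_nonneg_right h3le hα₁) (hw1i a))
        (Real.exp_nonneg _)
  have hDPpDs : HasMajorant (g := toB6 g R H) blk (D * B9Eq360Vprime.pPrime G E Qs Qs' Cinv Cinv' Q Q' * Ds)
      (fun a b => kP' * α₁ * (g.len a ^ 2)⁻¹ * Real.exp (-(ρ₂ * g.dist a b))) :=
    hasMajorant_mono (g := toB6 g R H) blk e4 fun a b =>
      mul_le_mul_of_nonneg_right (mul_le_mul_of_nonneg_right (mul_le_mul_of_nonneg_right h3le hα₁) (hw2i a))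
        (Real.exp_nonneg _)
  -- the first-order letters at rate ρ₂
  have hcKα : 0 ≤ cK * α₁ := mul_nonneg hcK hα₁
  have hKr := hasMajorant_rate_mono (R := R) (H := H) blk (cK * α₁) (fun a => (g.len a)⁻¹) hcKα hw1i hρ₂δ hdnn hK
  have hKsr := hasMajorant_rate_mono (R := R) (H := H) blk (cK * α₁) (fun a => (g.len a)⁻¹) hcKα hw1i hρ₂δ hdnn hKs
  -- (3.77)
  have hκP : 0 ≤ kappa349 κQ B₀ Bc Λ c := kappa349_nonneg hBc
  exact B9Ineq377POne.ineq377_op (R := R) (H := H) blk d δ₀ ρ₂ α β ρ Λ cK (kappa349 κQ B₀ Bc Λ c) kP' α₁ hcK hκP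
    hkP'n hα₁ hΛ hρ hα hβ hδ₀ hr hdnn htri hlen h261 hT1i hD' hDs' hP hDP hPDs hPp hDPp hPpDs hDPpDs hKr hKsr

/-! ## §5  (v1.1) The divergence-form letters of `V′` from the gradient form (3.60)/(3.61) and ONE commutator letter

(3.60) p. 402 displays `V′(A)λ` as a sum of commutator terms with coefficients `adA(·)` (transported by `R(U(·,·))`) applied
to covariant differences `∇_Uλ` and to `λ` itself, and (3.61) bounds it in this GRADIENT form, `|V′(A)λ(x)| ≦ O(1)(α₁(Lʲη)⁻¹
|∇_Uλ| + α₁(Lʲη)⁻²|λ|)`: letters `V′ = V⁰ + V¹∇`, `V¹ ≺ c_Bα₁(Lʲη)⁻¹e^{−δd}`, `V⁰ ≺ c_Cα₁(Lʲη)⁻²e^{−δd}`.  The divergence form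
used in §1–§4 is `V′ = ∇V¹ + (V⁰ + [V¹, ∇])` (ring identity), and the only new input is the size of the commutator `[V¹, ∇] =
V¹∇ − ∇V¹`: in print the (transported) covariant difference of the coefficient, `|∇^η_UA| < α₁(Lʲη)⁻²` on the domain (3.37)
p. 396 — the lattice Leibniz rule of the module docstring, kept here as ONE letter with a located majorant (`hComm`).
Nothing about the concrete `V′` of `B9Eq360Vprime` is asserted; the identification of `[V¹, ∇]` on a concrete carrier stays
with the reader (GAPS G-pv21g2-2). -/

/-- **(3.68)₃ `P′(A)·D*` from the GRADIENT form of `V′` and the commutator letter**: the hypotheses of §3's `ineq368_op_Ds`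
with `hV`/`hBpp`/`hCpp`/`hGDv` replaced by `hVg : V′ = V⁰ + V¹∇`, the (3.61) sizes `hV0`, `hV1`, the commutator letter `hComm :
V¹∇ − ∇V¹ ≺ c_Mα₁(Lʲη)⁻²e^{−δd}` ((3.37)) and the entry `hGD : G′(U)∇ ≺ B_{G3}Lʲη e^{−δd}` (Theorem 3.1, p. 398 remark):
`P′(A)·D* ≺ κ₃₆₈ᴰ(c_C + c_M for c_C)·α₁·(Lʲη)⁻¹·e^{−ρd}`.  Proof: §3 at `∇♯ := ∇`, `B″ := V¹`, `C″ := V⁰ + [V¹, ∇]`.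
[cite: Balaban1985BackgroundPropagators, (3.68) p.403 + (3.60)–(3.61) p.402 + (3.37) p.396 + (3.42) p.397 + p.398 remarks; Balaban1984PropagatorsII, Lemma 2.1 p.234] -/
theorem ineq368_op_Ds_of_comm (blk : W → g.Site) (d : ℕ)
    (δ₀ δ α β ρ Λ κQ cF cV κC BG BG3 BE BE3 Bc Bc' cB cC cM α₁ : ℝ)
    (hκQ : 0 ≤ κQ) (hcF : 0 ≤ cF) (hcV : 0 ≤ cV) (hκC : 0 ≤ κC) (hBG : 0 ≤ BG) (hBG3 : 0 ≤ BG3) (hBE : 0 ≤ BE)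
    (hBE3 : 0 ≤ BE3) (hBc : 0 ≤ Bc) (hBc' : 0 ≤ Bc') (hcB : 0 ≤ cB) (hcC : 0 ≤ cC) (hcM : 0 ≤ cM) (hα₁ : 0 ≤ α₁)
    (hΛ : 1 ≤ Λ) (hρ : 0 ≤ ρ) (hα : 0 ≤ α) (hβ : 0 ≤ β) (hδ₀ : 0 ≤ δ₀) (hr : ρ + 2 * ((2 * α + β) * δ₀) ≤ δ)
    (hdnn : ∀ a b : g.Site, 0 ≤ g.dist a b) (htri : Triangle254 (toB6 g R H)) (hlen : ∀ y : g.Site, 0 < g.len y)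
    (h261 : Ineq261 d (toB6 g R H) δ₀ β)
    (hT1 : ScaleTransfer g δ₀ α Λ (fun a => g.len a)) (hT1i : ScaleTransfer g δ₀ α Λ (fun a => (g.len a)⁻¹))
    (hT2i : ScaleTransfer g δ₀ α Λ (fun a => (g.len a ^ 2)⁻¹)) (hT4 : ScaleTransfer g δ₀ α Λ (fun a => (g.len a ^ 4)⁻¹))
    {G E V Qs Q Qs' Q' F₂ F₂s Cinv Cinv' Cp Ds D V0 V1 : Module.End ℝ (W → ℝ)}
    (h357 : Q' = Q + F₂) (h357s : Qs' = Qs + F₂s) (h365 : E = G + G * V * E)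
    (hC : Cinv' - Cinv = -(Cinv' * Cp * Cinv)) (hVg : V = V0 + V1 * D)
    (hG : HasMajorant (g := toB6 g R H) blk G (fun a b => BG * g.len a ^ 2 * Real.exp (-(δ * g.dist a b))))
    (hGD : HasMajorant (g := toB6 g R H) blk (G * D) (fun a b => BG3 * g.len a * Real.exp (-(δ * g.dist a b))))
    (hEDs : HasMajorant (g := toB6 g R H) blk (E * Ds) (fun a b => BE3 * g.len a * Real.exp (-(δ * g.dist a b))))
    (hVE : HasMajorant (g := toB6 g R H) blk (V * E) (fun a b => cV * α₁ * BE * Real.exp (-(δ * g.dist a b))))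
    (hV0 : HasMajorant (g := toB6 g R H) blk V0 (fun a b => cC * α₁ * (g.len a ^ 2)⁻¹ * Real.exp (-(δ * g.dist a b))))
    (hV1 : HasMajorant (g := toB6 g R H) blk V1 (fun a b => cB * α₁ * (g.len a)⁻¹ * Real.exp (-(δ * g.dist a b))))
    (hComm : HasMajorant (g := toB6 g R H) blk (V1 * D - D * V1)
      (fun a b => cM * α₁ * (g.len a ^ 2)⁻¹ * Real.exp (-(δ * g.dist a b))))
    (hQ : HasMajorant (g := toB6 g R H) blk Q (fun a b : g.Site => if a = b then κQ else 0))
    (hQs : HasMajorant (g := toB6 g R H) blk Qs (fun a b : g.Site => if a = b then κQ else 0))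
    (hF : HasMajorant (g := toB6 g R H) blk F₂ (fun a b : g.Site => if a = b then cF * α₁ else 0))
    (hFs : HasMajorant (g := toB6 g R H) blk F₂s (fun a b : g.Site => if a = b then cF * α₁ else 0))
    (hCinv : HasMajorant (g := toB6 g R H) blk Cinv
      (fun a b => Bc * (g.len a ^ 4)⁻¹ * Real.exp (-(δ * g.dist a b))))
    (hCinv' : HasMajorant (g := toB6 g R H) blk Cinv'
      (fun a b => Bc' * (g.len a ^ 4)⁻¹ * Real.exp (-(δ * g.dist a b))))
    (hCp : HasMajorant (g := toB6 g R H) blk Cp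
      (fun a b => κC * α₁ * g.len a ^ 4 * Real.exp (-(δ * g.dist a b)))) :
    HasMajorant (g := toB6 g R H) blk (B9Eq360Vprime.pPrime G E Qs Qs' Cinv Cinv' Q Q' * Ds)
      (fun a b => kappa368Ds κQ cF cV κC BG BG3 BG BE BE3 Bc Bc' cB (cC + cM) Λ (B6.c1 d δ₀ β) α₁ * α₁ * (g.len a)⁻¹ *
        Real.exp (-(ρ * g.dist a b))) := by
  have hV : V = D * V1 + (V0 + (V1 * D - D * V1)) := by rw [hVg]; abel
  -- C″ := V⁰ + [V¹, ∇] ≺ (c_C + c_M)α₁(Lʲη)⁻²e^{−δd} ([4] (2.52); the statement of `B9Ineq386RightEntry.hasMajorant_C₃_of_comm`,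
  -- inlined so that this module does not import the (3.86) file)
  have hCpp : HasMajorant (g := toB6 g R H) blk (V0 + (V1 * D - D * V1))
      (fun a b => (cC + cM) * α₁ * (g.len a ^ 2)⁻¹ * Real.exp (-(δ * g.dist a b))) := by
    refine hasMajorant_mono (g := toB6 g R H) blk (hasMajorant_add (g := toB6 g R H) blk hV0 hComm)
      fun a b => le_of_eq ?_
    ring
  exact ineq368_op_Ds (R := R) (H := H) blk d δ₀ δ α β ρ Λ κQ cF cV κC BG BG3 BE BE3 Bc Bc' cB (cC + cM) α₁ hκQ hcF
    hcV hκC hBG hBG3 hBE hBE3 hBc hBc' hcB (add_nonneg hcC hcM) hα₁ hΛ hρ hα hβ hδ₀ hr hdnn htri hlen h261 hT1 hT1i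
    hT2i hT4 h357 h357s h365 hC hV hG hGD hEDs hVE hV1 hCpp hQ hQs hF hFs hCinv hCinv' hCp

/-- **(3.68)₄ `D·P′(A)·D*` from the GRADIENT form of `V′` and the commutator letter** — §3's `ineq368_op_DDs` with the same
replacement of hypotheses as `ineq368_op_Ds_of_comm`: `D·P′(A)·D* ≺ κ₃₆₈ᴰ(B_X = B_D; c_C + c_M for c_C)·α₁·(Lʲη)⁻²·e^{−ρd}`.
[cite: Balaban1985BackgroundPropagators, (3.68) p.403 + (3.60)–(3.61) p.402 + (3.37) p.396 + (3.42) p.397 + p.398 remarks; Balaban1984PropagatorsII, Lemma 2.1 p.234] -/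
theorem ineq368_op_DDs_of_comm (blk : W → g.Site) (d : ℕ)
    (δ₀ δ α β ρ Λ κQ cF cV κC BG BG3 BD BE BE3 Bc Bc' cB cC cM α₁ : ℝ)
    (hκQ : 0 ≤ κQ) (hcF : 0 ≤ cF) (hcV : 0 ≤ cV) (hκC : 0 ≤ κC) (hBG : 0 ≤ BG) (hBG3 : 0 ≤ BG3) (hBD : 0 ≤ BD)
    (hBE : 0 ≤ BE) (hBE3 : 0 ≤ BE3) (hBc : 0 ≤ Bc) (hBc' : 0 ≤ Bc') (hcB : 0 ≤ cB) (hcC : 0 ≤ cC) (hcM : 0 ≤ cM)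
    (hα₁ : 0 ≤ α₁) (hΛ : 1 ≤ Λ) (hρ : 0 ≤ ρ) (hα : 0 ≤ α) (hβ : 0 ≤ β) (hδ₀ : 0 ≤ δ₀)
    (hr : ρ + 2 * ((2 * α + β) * δ₀) ≤ δ)
    (hdnn : ∀ a b : g.Site, 0 ≤ g.dist a b) (htri : Triangle254 (toB6 g R H)) (hlen : ∀ y : g.Site, 0 < g.len y)
    (h261 : Ineq261 d (toB6 g R H) δ₀ β)
    (hT1 : ScaleTransfer g δ₀ α Λ (fun a => g.len a)) (hT1i : ScaleTransfer g δ₀ α Λ (fun a => (g.len a)⁻¹))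
    (hT2i : ScaleTransfer g δ₀ α Λ (fun a => (g.len a ^ 2)⁻¹)) (hT4 : ScaleTransfer g δ₀ α Λ (fun a => (g.len a ^ 4)⁻¹))
    {G D E V Qs Q Qs' Q' F₂ F₂s Cinv Cinv' Cp Ds V0 V1 : Module.End ℝ (W → ℝ)}
    (h357 : Q' = Q + F₂) (h357s : Qs' = Qs + F₂s) (h365 : E = G + G * V * E)
    (hC : Cinv' - Cinv = -(Cinv' * Cp * Cinv)) (hVg : V = V0 + V1 * D)
    (hG : HasMajorant (g := toB6 g R H) blk G (fun a b => BG * g.len a ^ 2 * Real.exp (-(δ * g.dist a b))))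
    (hDG : HasMajorant (g := toB6 g R H) blk (D * G) (fun a b => BD * g.len a * Real.exp (-(δ * g.dist a b))))
    (hGD : HasMajorant (g := toB6 g R H) blk (G * D) (fun a b => BG3 * g.len a * Real.exp (-(δ * g.dist a b))))
    (hEDs : HasMajorant (g := toB6 g R H) blk (E * Ds) (fun a b => BE3 * g.len a * Real.exp (-(δ * g.dist a b))))
    (hVE : HasMajorant (g := toB6 g R H) blk (V * E) (fun a b => cV * α₁ * BE * Real.exp (-(δ * g.dist a b))))
    (hV0 : HasMajorant (g := toB6 g R H) blk V0 (fun a b => cC * α₁ * (g.len a ^ 2)⁻¹ * Real.exp (-(δ * g.dist a b))))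
    (hV1 : HasMajorant (g := toB6 g R H) blk V1 (fun a b => cB * α₁ * (g.len a)⁻¹ * Real.exp (-(δ * g.dist a b))))
    (hComm : HasMajorant (g := toB6 g R H) blk (V1 * D - D * V1)
      (fun a b => cM * α₁ * (g.len a ^ 2)⁻¹ * Real.exp (-(δ * g.dist a b))))
    (hQ : HasMajorant (g := toB6 g R H) blk Q (fun a b : g.Site => if a = b then κQ else 0))
    (hQs : HasMajorant (g := toB6 g R H) blk Qs (fun a b : g.Site => if a = b then κQ else 0))
    (hF : HasMajorant (g := toB6 g R H) blk F₂ (fun a b : g.Site => if a = b then cF * α₁ else 0))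
    (hFs : HasMajorant (g := toB6 g R H) blk F₂s (fun a b : g.Site => if a = b then cF * α₁ else 0))
    (hCinv : HasMajorant (g := toB6 g R H) blk Cinv
      (fun a b => Bc * (g.len a ^ 4)⁻¹ * Real.exp (-(δ * g.dist a b))))
    (hCinv' : HasMajorant (g := toB6 g R H) blk Cinv'
      (fun a b => Bc' * (g.len a ^ 4)⁻¹ * Real.exp (-(δ * g.dist a b))))
    (hCp : HasMajorant (g := toB6 g R H) blk Cp
      (fun a b => κC * α₁ * g.len a ^ 4 * Real.exp (-(δ * g.dist a b)))) :
    HasMajorant (g := toB6 g R H) blk (D * B9Eq360Vprime.pPrime G E Qs Qs' Cinv Cinv' Q Q' * Ds)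
      (fun a b => kappa368Ds κQ cF cV κC BG BG3 BD BE BE3 Bc Bc' cB (cC + cM) Λ (B6.c1 d δ₀ β) α₁ * α₁ *
        (g.len a ^ 2)⁻¹ * Real.exp (-(ρ * g.dist a b))) := by
  have hV : V = D * V1 + (V0 + (V1 * D - D * V1)) := by rw [hVg]; abel
  -- C″ := V⁰ + [V¹, ∇] ≺ (c_C + c_M)α₁(Lʲη)⁻²e^{−δd} ([4] (2.52); the statement of `B9Ineq386RightEntry.hasMajorant_C₃_of_comm`,
  -- inlined so that this module does not import the (3.86) file)
  have hCpp : HasMajorant (g := toB6 g R H) blk (V0 + (V1 * D - D * V1))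
      (fun a b => (cC + cM) * α₁ * (g.len a ^ 2)⁻¹ * Real.exp (-(δ * g.dist a b))) := by
    refine hasMajorant_mono (g := toB6 g R H) blk (hasMajorant_add (g := toB6 g R H) blk hV0 hComm)
      fun a b => le_of_eq ?_
    ring
  exact ineq368_op_DDs (R := R) (H := H) blk d δ₀ δ α β ρ Λ κQ cF cV κC BG BG3 BD BE BE3 Bc Bc' cB (cC + cM) α₁ hκQ
    hcF hcV hκC hBG hBG3 hBD hBE hBE3 hBc hBc' hcB (add_nonneg hcC hcM) hα₁ hΛ hρ hα hβ hδ₀ hr hdnn htri hlen h261 hT1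
    hT1i hT2i hT4 h357 h357s h365 hC hV hG hDG hGD hEDs hVE hV1 hCpp hQ hQs hF hFs hCinv hCinv' hCp

/-- **(3.77) with all seven entries discharged, from the GRADIENT form of `V′` and the commutator letter** — §4's
`ineq377_op_of_349_368` with `hV`/`hBpp`/`hCpp`/`hGDv` replaced by `hVg`, `hV0`, `hV1`, `hComm`, `hGD` (the first-order
letters `K`, `K*` of (3.70)/(3.74) keep their constant `c_K`; the commutator letter has `c_M`): the same majorant with
`c_C + c_M` for `c_C` inside `κ₃₆₈ᴰ`.
[cite: Balaban1985BackgroundPropagators, (3.76)–(3.77) pp.405–406 + (3.68) p.403 + (3.60)–(3.61) p.402 + (3.37) p.396 + (3.49) p.399 + Thm 3.1/3.2 pp.397–398; Balaban1984PropagatorsII, Lemma 2.1 p.234] -/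
theorem ineq377_op_of_349_368_of_comm (blk : W → g.Site) (d : ℕ)
    (δ₀ δ α β ρ₂ ρ Λ κQ cF cV κC B₀ BE BE3 Bc Bc' cB cC cM cK α₁ : ℝ)
    (hκQ : 0 ≤ κQ) (hcF : 0 ≤ cF) (hcV : 0 ≤ cV) (hκC : 0 ≤ κC) (hB₀ : 0 ≤ B₀) (hBE : 0 ≤ BE) (hBE3 : 0 ≤ BE3)
    (hBc : 0 ≤ Bc) (hBc' : 0 ≤ Bc') (hcB : 0 ≤ cB) (hcC : 0 ≤ cC) (hcM : 0 ≤ cM) (hcK : 0 ≤ cK) (hα₁ : 0 ≤ α₁)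
    (hΛ : 1 ≤ Λ) (hρ : 0 ≤ ρ) (hα : 0 ≤ α) (hβ : 0 ≤ β) (hδ₀ : 0 ≤ δ₀)
    (hr₂ : ρ₂ + 2 * ((2 * α + β) * δ₀) ≤ δ) (hr : ρ + 2 * ((α + β) * δ₀) ≤ ρ₂)
    (hdnn : ∀ a b : g.Site, 0 ≤ g.dist a b) (htri : Triangle254 (toB6 g R H)) (hlen : ∀ y : g.Site, 0 < g.len y)
    (h261 : Ineq261 d (toB6 g R H) δ₀ β)
    (hT1 : ScaleTransfer g δ₀ α Λ (fun a => g.len a)) (hT2 : ScaleTransfer g δ₀ α Λ (fun a => g.len a ^ 2))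
    (hT1i : ScaleTransfer g δ₀ α Λ (fun a => (g.len a)⁻¹)) (hT2i : ScaleTransfer g δ₀ α Λ (fun a => (g.len a ^ 2)⁻¹))
    (hT4 : ScaleTransfer g δ₀ α Λ (fun a => (g.len a ^ 4)⁻¹))
    {G D Ds D' Ds' K Ks E V Qs Q Qs' Q' F₂ F₂s Cinv Cinv' Cp V0 V1 : Module.End ℝ (W → ℝ)}
    (hD' : D' = D + K) (hDs' : Ds' = Ds + Ks)
    (h357 : Q' = Q + F₂) (h357s : Qs' = Qs + F₂s) (h365 : E = G + G * V * E)
    (hC : Cinv' - Cinv = -(Cinv' * Cp * Cinv)) (hVg : V = V0 + V1 * D)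
    (hG : HasMajorant (g := toB6 g R H) blk G (fun a b => B₀ * g.len a ^ 2 * Real.exp (-(δ * g.dist a b))))
    (hDG : HasMajorant (g := toB6 g R H) blk (D * G) (fun a b => B₀ * g.len a * Real.exp (-(δ * g.dist a b))))
    (hGDs : HasMajorant (g := toB6 g R H) blk (G * Ds) (fun a b => B₀ * g.len a * Real.exp (-(δ * g.dist a b))))
    (hGD : HasMajorant (g := toB6 g R H) blk (G * D) (fun a b => B₀ * g.len a * Real.exp (-(δ * g.dist a b))))
    (hE : HasMajorant (g := toB6 g R H) blk E (fun a b => BE * g.len a ^ 2 * Real.exp (-(δ * g.dist a b))))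
    (hEDs : HasMajorant (g := toB6 g R H) blk (E * Ds) (fun a b => BE3 * g.len a * Real.exp (-(δ * g.dist a b))))
    (hVE : HasMajorant (g := toB6 g R H) blk (V * E) (fun a b => cV * α₁ * BE * Real.exp (-(δ * g.dist a b))))
    (hV0 : HasMajorant (g := toB6 g R H) blk V0 (fun a b => cC * α₁ * (g.len a ^ 2)⁻¹ * Real.exp (-(δ * g.dist a b))))
    (hV1 : HasMajorant (g := toB6 g R H) blk V1 (fun a b => cB * α₁ * (g.len a)⁻¹ * Real.exp (-(δ * g.dist a b))))
    (hComm : HasMajorant (g := toB6 g R H) blk (V1 * D - D * V1)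
      (fun a b => cM * α₁ * (g.len a ^ 2)⁻¹ * Real.exp (-(δ * g.dist a b))))
    (hQ : HasMajorant (g := toB6 g R H) blk Q (fun a b : g.Site => if a = b then κQ else 0))
    (hQs : HasMajorant (g := toB6 g R H) blk Qs (fun a b : g.Site => if a = b then κQ else 0))
    (hF : HasMajorant (g := toB6 g R H) blk F₂ (fun a b : g.Site => if a = b then cF * α₁ else 0))
    (hFs : HasMajorant (g := toB6 g R H) blk F₂s (fun a b : g.Site => if a = b then cF * α₁ else 0))
    (hCinv : HasMajorant (g := toB6 g R H) blk Cinv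
      (fun a b => Bc * (g.len a ^ 4)⁻¹ * Real.exp (-(δ * g.dist a b))))
    (hCinv' : HasMajorant (g := toB6 g R H) blk Cinv'
      (fun a b => Bc' * (g.len a ^ 4)⁻¹ * Real.exp (-(δ * g.dist a b))))
    (hCp : HasMajorant (g := toB6 g R H) blk Cp
      (fun a b => κC * α₁ * g.len a ^ 4 * Real.exp (-(δ * g.dist a b))))
    (hK : HasMajorant (g := toB6 g R H) blk K (fun a b => cK * α₁ * (g.len a)⁻¹ * Real.exp (-(δ * g.dist a b))))
    (hKs : HasMajorant (g := toB6 g R H) blk Ks (fun a b => cK * α₁ * (g.len a)⁻¹ * Real.exp (-(δ * g.dist a b)))) :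
    HasMajorant (g := toB6 g R H) blk
      (pOne D D' Ds Ds' (B9Eq360Vprime.pOp G Qs Cinv Q) (B9Eq360Vprime.pPrime G E Qs Qs' Cinv Cinv' Q Q'))
      (fun a b => kappa377 cK (kappa349 κQ B₀ Bc Λ (B6.c1 d δ₀ β))
        (2 * (kappa368 κQ cF cV κC B₀ B₀ BE Bc Bc' Λ (B6.c1 d δ₀ β) α₁
          + kappa368Ds κQ cF cV κC B₀ B₀ B₀ BE BE3 Bc Bc' cB (cC + cM) Λ (B6.c1 d δ₀ β) α₁))
        Λ (B6.c1 d δ₀ β) α₁ * α₁ * (g.len a ^ 2)⁻¹ * Real.exp (-(ρ * g.dist a b))) := by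
  have hV : V = D * V1 + (V0 + (V1 * D - D * V1)) := by rw [hVg]; abel
  -- C″ := V⁰ + [V¹, ∇] ≺ (c_C + c_M)α₁(Lʲη)⁻²e^{−δd} ([4] (2.52); the statement of `B9Ineq386RightEntry.hasMajorant_C₃_of_comm`,
  -- inlined so that this module does not import the (3.86) file)
  have hCpp : HasMajorant (g := toB6 g R H) blk (V0 + (V1 * D - D * V1))
      (fun a b => (cC + cM) * α₁ * (g.len a ^ 2)⁻¹ * Real.exp (-(δ * g.dist a b))) := by
    refine hasMajorant_mono (g := toB6 g R H) blk (hasMajorant_add (g := toB6 g R H) blk hV0 hComm)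
      fun a b => le_of_eq ?_
    ring
  exact ineq377_op_of_349_368 (R := R) (H := H) blk d δ₀ δ α β ρ₂ ρ Λ κQ cF cV κC B₀ BE BE3 Bc Bc' cB (cC + cM) cK α₁
    hκQ hcF hcV hκC hB₀ hBE hBE3 hBc hBc' hcB (add_nonneg hcC hcM) hcK hα₁ hΛ hρ hα hβ hδ₀ hr₂ hr hdnn htri hlen h261
    hT1 hT2 hT1i hT2i hT4 hD' hDs' h357 h357s h365 hC hV hG hDG hGDs hGD hE hEDs hVE hV1 hCpp hQ hQs hF hFs hCinv
    hCinv' hCp hK hKs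

end Literature.MathematicalPhysics.QuantumFieldTheory.Balaban1983to89.B9Ineq368PPrimeDs

end
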